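import Summits.Parity.BatemanHorn.Theses.RoughValueTransport
import Literature.NumberTheory.Sieve.RoughNumbersBuchstab
import Literature.NumberTheory.LFunctions.RHWave0PNTProofs
import Literature.NumberTheory.Sieve.BuchstabLimitFact
import Literature.NumberTheory.Sieve.BatemanHornProofs

/-!
# Disproof of `BalancedSemiprimeLayer` (crux stmt-Parity-9469, route RoughValueTransport) — findings

Standing-adversary work file (cdisprove, generation 2; agent refuter-cdisprove-stmt-Parity-9469-g2-0).
Everything below this docblock is MACHINE-CHECKED (`lean check` rc 0, 0 `sorry`, axioms ⊆
{propext, Classical.choice, Quot.sound} — printed for the nine main theorems); prose lives only in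
docstrings. Names below are relative to `Summit.Parity.BatemanHorn.Cruxes.BalancedSemiprimeLayer.Disproof`.
(Generation 1's file — 1043 lines, same verdict, evidence 20260815T224158Z-Disproof.lean — is not
readable from a seat jail; this file re-derives its results from scratch, with different proofs
(one limit theorem instead of two-sided O-bounds) and adds §3's sharp `2δ ≤ ε`, §4's strengthenings
3–4, §6, §7, and LANDS everything under `Theorems/BalancedSemiprimeLayer/Negative/`.)

## Verdict (gen 2, cycles 1–2): the crux SURVIVES — no refutation, misstated or substantive; it is now
## reduced to its degree-≥-3 residue `stub_higherLayer` = `LayerHigher` (open problem in both directions)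

The crux (`crux_iff`, by `Iff.rfl`): for every Bateman–Horn system `f` of `k` polynomials and every
`ε > 0` there is `δ ∈ (0, 1/4]` with, eventually in `x : ℕ`,
`Φ_f(x, δ) ≤ P_f(x) + ε·x/(log x)^k`, where `Φ_f(x, δ) = roughCount f δ x =
#{1 ≤ n ≤ x : ∀ i, fᵢ(n) > 0 and no prime p < x^{deg fᵢ·(1−δ)/2} divides fᵢ(n)}` and
`P_f = polyPrimeCount f`. Read back symbol by symbol: `p ∈ Finset.range ⌈x^e⌉₊ ∧ p.Prime` is exactly
"prime `p < x^e`"; the casts ℕ→ℤ (divisibility, positivity) and ℕ→ℝ (counts) are benign;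
`ε * x / Real.log x ^ k` parses as `(εx)/((log x)^k)` (at `x ≤ 1` it is the junk value `…/0 = 0` or
`ε·x`, invisible under `∀ᶠ`); `P_f` counts `n` from `0` and prime values of ANY size (both only help the
inequality); for `δ ≤ 1/4 < 1/3` a rough value has at most two prime factors eventually, so the excess
`Φ_f − P_f` counts balanced semiprime values (plus `O(Σ deg fᵢ)` values `= 1` and `O(√x)` prime squares).

STATUS AT THE 2026-08-16T05:30Z BOUNDARY (read from the tree on resume). The line
`smooth-modulus-twisted-hooley` (lead prover-line-stmt-Parity-9469-0/1; its lever is the divisor-pair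
sieve + twisted Hooley sum of the deg-2 briefing below) has LANDED the crux for every coordinate of
degree ≤ 2: `Theorems/RoughValueTransportBalancedSemiprimeLayer{LinearLayer (p73627), UniformTypeI
(p74271), TwistedHooley (p74670), QuadraticDictionary (p72470), QuadraticSieve* (p74679–p76614),
DegreeLeTwo}` + Literature `LinearPolynomialRoughCompositeValues` (p73231),
`PolynomialCongruencesTypeIUniform` (p73867), `QuadraticRootsTwistedHooley` (p74417); in particular
`layerConclusion_of_natDegree_le_two` (the crux for every BH system of degree ≤ 2, unconditional) and
`balancedSemiprimeLayer_iff_higherLayer`: the crux is now EQUIVALENT to its degree-≥-3 residue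
`stub_higherLayer` (= the route's foreseen `LayerHigher`), see §8 Targets. Everything below about
degrees 1–2 is therefore history/briefing; the live object is the cubic-and-higher coordinate layer.

Heuristic size of the excess (RoughValueLaw shape + Bateman–Horn): `[(1 + log((1+δ)/(1−δ)))^k − 1]·
(C(f)/∏ deg fᵢ)·x/(log x)^k ≈ 2kδ·(C(f)/∏deg fᵢ)·x/(log x)^k`, which IS `o_{δ→0}` of the tolerance —
and is machine-checked EXACTLY for `f = (X)`: `tendsto_layer_X`. A counterexample would therefore be
an ANTI-Bateman–Horn phenomenon (balanced semiprime values of some `fᵢ` more frequent than the random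
model by a constant factor, uniformly as `δ → 0`); nothing of the kind is known, and the predecessors'
exact counts (rattack job j002077, x ≤ 10⁷; this file's job j006835, x = 10⁸, see NUMERICS below: systems
X, (X,X+2), X²+1, (X,X²+X+1), X³+2, δ ∈ {.25,…,.02}) show the layer BELOW the prediction and creeping up to it.
An unconditional refutation is out of reach for `deg ≥ 2` or `k ≥ 2`: it would need a LOWER bound for
rough polynomial values at sieve depth `u ≤ 8/3`, i.e. Bunyakovsky/Dickson-strength input.

## Index of results (all proved)

* §0 `roughCount`, `LayerConclusion`, `crux_iff`.
* §1 Witness systems: `isBatemanHornSystem_X`, `isBatemanHornSystem_twin` (`(X, X+2)`), and the three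
  MUTILATED systems `isSystemWithoutNotAssociated_X_X` (`(X, X)`), `isSystemWithoutIrreducible_X_sq`
  (`(X²)`), `isSystemWithoutNoFixedPrimeDivisor_two_X` (`(2, X)`); the count identities
  `roughCount_X / _X_X / _two_X` (`= Φ(x, x^{(1−δ)/2}) = #roughIcc ⌈x^{(1−δ)/2}⌉₊ x`),
  `roughCount_X_sq` (`= Φ(x, x^{1−δ})`), `polyPrimeCount_X / _X_X / _two_X` (`= π(x)`),
  `polyPrimeCount_X_sq` (`= 0`).
* §2 Analytic core, from PROVED tree theorems only (PNT
  `Literature.NumberTheory.LFunctions.primeCounting_isEquivalent_holds`; the integer Buchstab law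
  `Literature.NumberTheory.Sieve.exists_abs_card_roughIcc_sub_main_le_of_rpow` = Lichtman 2025
  Lemma 6.1 / Harman App. A.2; `buchstabOmega_eq_of_mem_Icc_two_three`, `buchstabOmega_eq_inv`):
  `tendsto_primeCounting_mul_log_div_nat`; `tendsto_card_roughIcc_mul_log_div`
  (`Φ(x, x^θ)·log x/x → ω(1/θ)/θ` for `1/3 ≤ θ < 1`); `tendsto_roughCount_X`
  (`→ 1 + log((1+δ)/(1−δ))`); `tendsto_roughCount_X_sq` (`→ 1`); `tendsto_layer_X`
  (`(Φ_{(X)} − P_{(X)})·log x/x → log((1+δ)/(1−δ))`, i.e. layer `≈ 2δ x/log x`).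
* §3 (b) TIGHTNESS at `(X)`: `layer_X_eventually_gt / _lt` (two-sided, any constant `c` on the right
  side of `log((1+δ)/(1−δ))`); `log_ratio_le_of_eventually_layer_X` (an admissible pair `(ε, δ)` at
  `(X)` forces `log((1+δ)/(1−δ)) ≤ ε`); `two_mul_delta_le_of_eventually_layer_X` (**`2δ ≤ ε`** — exactly
  the heuristic threshold `2kδ·C(f)/∏deg ≤ ε` at `k = 1`, `C = 1`); and the POSITIVE instance
  `layerConclusion_X`: the crux HOLDS at `(X)` with `δ(ε) = min(1/4, ε/4)`.
* §4 (c) REFUTED NATURAL STRENGTHENINGS (each false already at a linear BH system):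
  `not_balancedSemiprimeLayerStrongTolerance` (tolerance `εx/(log x)^{k+1}`);
  `not_balancedSemiprimeLayerUniformDelta` (`∃ δ ∀ ε`); `not_balancedSemiprimeLayerQuarter` (the cap
  `δ = 1/4` itself, for all `ε`); `not_coordinatewiseLayerBound` (bounding EACH coordinate's
  rough-non-prime values separately by `εx/(log x)^k`: false for `(X, X+2)` — the layer of a system is a
  JOINT `k`-dimensional sifting problem; the other coordinates must stay rough).
* §5 (a) LOAD-BEARING HYPOTHESES of `IsBatemanHornSystem` ("any proof must use H"):
  `balancedSemiprimeLayer_false_without_notAssociated` (witness `(X, X)`: the tolerance exponent `k` is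
  tight against duplicated coordinates); `balancedSemiprimeLayer_false_without_irreducible` (witness
  `(X²)`: a repeated factor; a squarefree reducible coordinate would be harmless);
  `balancedSemiprimeLayer_false_without_noFixedPrimeDivisor` (witness `(2, X)`: a prime CONSTANT
  coordinate is sifted by no prime, `x^{0·(1−δ)/2} = 1`). NOT load-bearing:
  `crux_iff_withoutLeadingCoeffPos` (the crux is EQUIVALENT to its variant without `leadingCoeff_pos`);
  `crux_imp_layerConclusion_of_natDegree_pos` (`hasNoFixedPrimeDivisor` matters ONLY against prime
  constants: a genuine fixed prime divisor empties `Φ_f` eventually — `roughCount_eq_zero_of_fixed_prime`,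
  `exists_dvd_eval_of_le_polyRootCountMod`).
* §6 (d) STRUCTURE: `roughCount_mono` (`Φ_f(x, δ)` is monotone in `δ`), `layerConclusion_iff_eventually_small`
  (the cap `δ ≤ 1/4` is immaterial; "∃ δ" = "all small enough δ"), `natDegree_pos_of_isBatemanHornSystem`
  (BH systems contain no constants), `layerConclusion_fin_zero` (the `k = 0` slice is TRUE).
* §7 (e) RELATIVE CONSISTENCY (meta-result): `cruxConclusion_of_roughValueLaw_of_sieveCalibration_of_batemanHorn`
  — `RoughValueLaw → SieveCalibration → BatemanHorn → (the crux's conclusion for every BH system)`, the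
  CONVERSE of the route's Assembly: modulo the other crux and the provable-now calibration the crux IS
  the lower half of Bateman–Horn. Consequence for disprovers: a refutation of `BalancedSemiprimeLayer`
  refutes `RoughValueLaw ∨ SieveCalibration ∨ BatemanHorn` — it cannot be cheaper than an anti-BH
  phenomenon or a failure of the Buchstab shape; consequence for provers: the crux is BH-strength
  information about the boundary layer `u ↓ 2` (given RoughValueLaw), not a technical side condition.
* §7b (f) LOWER HALF: `polyPrimeCount_le_cruxCount_add` / `polyPrimeCount_le_roughCount_add` —
  `P_f(x) ≤ Φ_f(x, δ) + K(f) + k(2√x + 1)` for every family with positive leading coefficients and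
  degrees `≥ 1`, every `δ ≥ 0`: the crux can fail only from ABOVE; it is exactly a statement about
  the balanced-semiprime layer (and this is the upper-bound half of the Assembly squeeze).
* LANDED in the tree (importable; `Summit.Parity.BatemanHorn.Theorems.BalancedSemiprimeLayer.Negative.*`,
  all `--supports stmt-Parity-9469`, kernel-checked): `NatDegreePos` (p69872), `RoughLayerAsymptotics`
  (p69871), `Structure` (p69933), `Decoration` (p70124), `TightAtX` (p70220), `FalseWithoutNotAssociated`
  (p70432), `FalseWithoutIrreducible` (p70433), `FalseWithoutNoFixedPrimeDivisor` (p70434),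
  `Strengthenings` (p70435), `RelativeConsistency` (p70540), `LowerHalf` (p70962, submitted at this boundary). They restate §1–§7
  WITHOUT the helper defs `roughCount`/`LayerConclusion` (explicit crux expressions), so other seats can
  `import` them.
* §8 TARGETS — the registered stubs of the picked line `smooth-modulus-twisted-hooley` (skeleton
  `Cruxes/BalancedSemiprimeLayer/Lines/smooth_modulus_twisted_hooley.lean`, `ledger workitem stubs`):
  - `stub_degreeSplit` (linear-thin → quadratic-thin → higher-thin → crux): TRUE — it is the glue, landed
    as `…DegreeLeTwo.stub_transfer` / `balancedSemiprimeLayer_iff_higherLayer` (union bound over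
    coordinates, `natDegree_pos_of_isBatemanHornSystem`, monotonicity in `δ`). Nothing to attack.
  - `stub_higherLayer : ∀ k f, IsBatemanHornSystem f → ∀ i, 3 ≤ (f i).natDegree → CoordLayerThin f i`
    (the degree-≥-3 coordinate layer, = `LayerHigher`): SURVIVES, no kill possible with present
    knowledge, NOT misstated. Machine-checked frame: NECESSARY — the crux implies it verbatim
    (`Negative.HigherLayerNecessary`, p75295, drefute g3), so with the landed stubs crux ⟺ stub;
    RELATIVELY CONSISTENT mod `RoughValueLaw ∧ SieveCalibration ∧ BatemanHorn` (§7 here, p70540, and its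
    coordinate form in p75295); NO CHEAP KILL — a counterexample forces, for every `δ` and infinitely
    many `x`, prime factors `≥ x^{deg fᵢ(1−δ)/2} ≥ x^{9/8}` of some `fᵢ(n)`, `n ≤ x`, i.e.
    `P⁺(∏_{n≤x} f(n)) ≥ x^{3/2−o(1)}` i.o. for a cubic against the record `x^{1+10⁻⁵²}` (Irving 2015)
    (`Negative.LargePrimeFactors`, p75976, drefute g3); NO TYPE-I PROOF (balanced factors exceed the
    number of terms; Ford–Maynard Thm 4.16). This disprover's own data: the cubic `X³+2` layer at
    `x = 10⁶` is thin, monotone in `δ` and below the asymptotic prediction (NUMERICS), and drefute g3's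
    finite-`x` prediction matches it to ±5 %. Recommendation concurs with drefute/lead: promote the stub
    to the item `LayerHigher` (difficulty open-problem); the refuter's target for it is the crux itself.
* §9 Near-misses: none sorried. Deliberately NOT attempted in Lean: uniformity of `δ` in `f` for
  fixed `k` (false — `C(qX+1) = q/φ(q)` is unbounded — but a proof needs Buchstab's law in arithmetic
  progressions, absent from the tree); any `deg ≥ 2` instance (open either way, see below).

## Why it resists — briefing for provers (degree-graded; matches the rattack/grounder notes)

* deg-1 coordinates (all-linear systems, every `k`) — NOW PROVED in the tree (`…LinearLayer`, p73627);
  the briefing as written before that: provable now in principle. Layer ⊆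
  `⋃ᵢ ⋃_{p₁ ∈ [zᵢ, √(aᵢx+bᵢ)]} {n ≤ x : p₁ ∣ fᵢ(n), every fⱼ(n) zⱼ-rough}`; each inner set is ONE
  residue class mod `p₁` of length `x/p₁ ≥ x^{1/2−o(1)}`, sifted in dimension `k` up to
  `z = x^{(1−δ)/2}` (`s = log(x/p₁)/log z ≈ 1`): a `k`-dimensional Selberg/β UPPER-bound sieve at level
  `(x/p₁)^{1−η}` gives `≪_f (x/p₁)(log x)^{−k}`, and `Σ_{p₁} 1/p₁ = log(1/(1−δ)) + o(1) ≈ δ` (Mertens), so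
  layer `≪_f δ·x/(log x)^k`; take `δ = c_f·ε`. No Bombieri–Vinogradov is needed (each `p₁ ≤ √x` is an
  individual modulus). For `f = (X)` this file does it via Buchstab asymptotics (`layerConclusion_X`).
  QUANTITATIVE TARGET any proof must respect: `2δ ≤ ε` at `(X)` (§3), heuristically
  `δ ≲ ε·∏deg fᵢ/(2k·C(f))` in general — so `δ` MUST depend on `f` (not only on `k, ε`).
* deg-2 coordinates — NOW PROVED in the tree along route (α) below (`…UniformTypeI` p74271,
  `…TwistedHooley` p74670 with the Q-uniform twisted Hooley lever `Literature…QuadraticRootsTwistedHooley`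
  p74417, `…QuadraticSieve*`, `…DegreeLeTwo`); the briefing as written before that: balanced means
  `p₁ ∈ [x^{1−δ}, ≍x]`; the progression `n ≡ ν (mod p₁)` has only
  `≍ x^δ` terms, so sieving it INDIVIDUALLY reaches level `x^δ` and loses exactly the factor `δ` one
  needs (bound `≪ x/(log x)^k`, `δ` cancelled). Two ways in. (α) [generation 1's hint, re-derived
  here] count PAIRS: `A = {(n, d) : n ≤ x, d ∣ fᵢ(n), d ∈ [x^{1−δ}, x^{1+δ}]}` has
  `|A| ≈ 2ρ̄·δ·x·log x`, and a balanced semiprime value is a pair with `d` AND `fᵢ(n)/d` prime; sift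
  BOTH by the primes `q < x^η` — a 2-dimensional Selberg UPPER bound gives
  `≪ |A|·(c/(η log x))² ≍ (δ/η²)·x/log x`, i.e. the layer bound with `δ(ε) ≍ ε·η²`. Primality of `d`
  is OUTPUT of the sieve, so NO averaging over prime moduli (DFI/Tóth) is needed. The sieve
  remainder is `Σ_{e₁e₂ ≤ x^{sη}} λ Σ_{d ∈ range, e₁ ∣ d} r(d·e₂)` with
  `r(m) = #{n ≤ x : m ∣ n² − D} − xρ(m)/m = −Σ_{ν} (ψ((x−ν)/m) − ψ(−ν/m))` (`ψ` = sawtooth): after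
  Erdős–Turán/Vaaler smoothing in `h ≤ H = x^{o(1)}` this is a sum over the SMOOTH variable `d` of
  Weyl sums of the roots, `Σ_{d ≤ N} S(h, d·e₂)` twisted by the fixed sieve modulus `e₂ ≤ x^{sη}` —
  Hooley's 1963 divisor-problem technology (Gauss sums → Kloosterman sums → Weil). The tree PROVES the
  untwisted fixed-`h` bound `Σ_{d ≤ N} S(h, d) ≪_h N^{3/4} log² N`
  (`hooley1963_quadraticRoots_allModuli_logSqSaving_holds`, `QuadraticRootsAllModuliPowerSavingProofs.lean`),
  which at `N = x^{1+δ}` saves `x^{(1+δ)/4−o(1)}` — ample. THE GAP (size L–XL, not open-problem): the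
  same bound TWISTED by `e₂ ≤ x^{sη}` (roots restricted to a class mod `e₂`) and UNIFORM polynomially
  in `(h, e₂)`; it is within the scope of Hooley's method but is neither in the tree nor verbatim in
  print. So the quadratic layer for `k = 1`, `f = X² − D` is technology-adjacent to provable (for a
  quadratic coordinate inside a system the other coordinates' roughness rides along: dimension
  `k + 1`, and linear coordinates add only progressions). (β) the route's own
  suggestion — roots mod `p₁d` on average over PRIME `p₁ ~ x^{1−δ}` (de la Bretèche–Drappeau
  doi:10.4171/jems/951, Merikoski arXiv:1908.08816; the tree's `Iwaniec1978.proposition1_holds`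
  stops at `M ≤ x^{1−3ε}`) — is harder and not in print as such; (α) makes it unnecessary.
* deg ≥ 3 coordinates: `p₁ ~ x^{d(1−δ)/2} > x` = number of terms, so the sets
  `{n ≤ x : p₁ ∣ fᵢ(n)}` have `O(d)` elements and no structure: no Type-I/II information at all
  (the thin-set regime in the scope remarks of `Literature.Barriers.Parity.FordMaynardLowLevel`).
  Honest status: the catalogued Ford–Maynard theorems concern LOWER bounds / asymptotics from
  (I) ∧ (II); for this UPPER-bound crux they document the absence of any handle rather than an
  impossibility theorem. OPEN.
* Barriers: SelbergParityBarrier / LinearSieveOptimality do NOT bite (an upper bound of the right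
  order with a constant `→ 0` in `δ` is parity-insensitive: the balanced-semiprime layer is a set of
  products of exactly two primes in prescribed ranges, counted from above); no catalogued barrier
  refutes or blocks the crux; `deg ≥ 3` is blocked by lack of tools (thinness), see above.

## Numerics (exact counts; farm job j006835, pure-Python bytearray sieves, script numerics/layer_sweep.py, 8 min on 1 core)

`E = Φ_f(x,δ) − P_f(x)` against the prediction `E/P → (1 + log((1+δ)/(1−δ)))^k − 1 (≈ 2kδ)`
(RoughValueLaw shape + Bateman–Horn); `ratio = (E/P)/pred`. Quadratic and twin systems at `x = 10⁸`,
the cubic at `x = 10⁶` (its sieve runs over the 5·10⁷ primes `≤ x^{3/2}`). Cross-checks: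
`P_{(X,X+2)}(10⁸) = 440312 = π₂(10⁸)`; `Φ_{X²+1}(10⁶, δ = 0.2) = 68487` reproduces the route's filing
count at `u = 2.5` exactly (the job's quadratic `P` omits `n = 1`, value `2`: `P = 3954180 + 1`).

  δ      X²+1, x=10⁸ (P=3954181)        (X,X+2), x=10⁸ (P=440312)      X³+2, x=10⁶ (P=33795)
         E        E/P    pred  ratio    E       E/P    pred   ratio    E      E/P    pred  ratio
  0.25   1621410  .4100  .5108  .803    423461  .9617  1.2826  .750    12752  .3773  .5108  .739
  0.20   1196835  .3027  .4055  .747    296912  .6743   .9753  .691     9156  .2709  .4055  .668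
  0.15    793531  .2007  .3023  .664    189187  .4297   .6959  .617     5893  .1744  .3023  .577
  0.10    426489  .1079  .2007  .538     96854  .2200   .4416  .498     2947  .0872  .2007  .435
  0.07    237697  .0601  .1402  .429     52559  .1194   .3001  .398     1517  .0449  .1402  .320
  0.05    132525  .0335  .1001  .335     28551  .0648   .2102  .309      791  .0234  .1001  .234
  0.03     52045  .0132  .0600  .219     11081  .0252   .1236  .204      276  .0082  .0600  .136
  0.02     24024  .0061  .0400  .152      5003  .0114   .0816  .139       95  .0028  .0400  .070

Trend in `x` (X²+1, δ = 0.25): ratio .305 / .354 / .369 / .410 at x = 2·10⁴ / 3·10⁵ / 10⁶ / 10⁸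
(first two: rattack job j002077; 10⁶: hub smoke run numerics/smoke_1e6.txt). Reading: the layer is
THIN, monotone in `δ`, and at every point BELOW the asymptotic prediction (ratio < 1, creeping up
like `1/log z`), uniformly over degrees 1–3 and `k = 1, 2`; the deficit at small `δ` is the finite-`x`
effect that balanced pairs `p₁ ≤ p₂ ≤ p₁·x^{≈2δ}` need `x^δ ≫ 1` to exist at all. No anomaly and no
counterexample signal: the data sit comfortably INSIDE the crux (which only asks for `E ≤ εx/(log x)^k`
for some `δ(ε)`), with the universal shape `(1 + log((1+δ)/(1−δ)))^k − 1` visible in `k`.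

## Attempts log (gen 2, cycle 1): what was thrown at the crux, and why each attack failed

1. Degenerate / limiting regimes: `k = 0` TRUE (`layerConclusion_fin_zero`); constants cannot occur
   (`natDegree_pos_of_isBatemanHornSystem`); the `δ`-cap and `δ`-monotonicity make `∃ δ ≤ 1/4` harmless
   (§6); `δ → 0⁺`: the `(X)`-layer constant `log((1+δ)/(1−δ)) → 0` continuously (`tendsto_layer_X` holds
   for `δ = 0` too, limit `0`), consistent with `∀ ε ∃ δ`.
2. Junk-operator audit of the signature: nothing exploitable (see Verdict).
3. Hypothesis mutation: three load-bearing (refuted without them), two decorative (§5).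
4. Natural strengthenings: four refuted (§4); in the `ε–δ` dependence the statement sits exactly at
   the heuristic threshold (§3), so it is neither paddable nor vacuous.
5. Substantive (anti-BH bias): no counterexample family known for balanced semiprime values of
   polynomials; Aurifeuillean identities (e.g. `4m⁴+1 = (2m²+2m+1)(2m²−2m+1)`, i.e. `n²+1` at `n = 2m²`)
   produce perfectly balanced factorisations but only on `O(√x)` arguments — negligible.
-/

namespace Summit.Parity.BatemanHorn.Cruxes.BalancedSemiprimeLayer.Disproof

open Filter Finset Polynomial Real Asymptotics
open scoped Topology
open Literature.NumberTheory.Sieve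
open Summit.Parity.BatemanHorn.Theses.RoughValueTransport (BalancedSemiprimeLayer)

/-! ### The crux, one system at a time -/

/-- `Φ_f(x, δ)`: the left-hand count of the crux — the `1 ≤ n ≤ x` all of whose values `fᵢ(n)` are
positive and free of prime factors `p < x^{deg fᵢ (1 − δ)/2}`. [folklore] -/
noncomputable def roughCount {k : ℕ} (f : Fin k → ℤ[X]) (δ : ℝ) (x : ℕ) : ℕ :=
  ((Icc 1 x).filter (fun n : ℕ => ∀ i, 0 < (f i).eval (n : ℤ) ∧
    ∀ p ∈ range ⌈(x : ℝ) ^ (((f i).natDegree : ℝ) * (1 - δ) / 2)⌉₊,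
      p.Prime → ¬ ((p : ℤ) ∣ (f i).eval (n : ℤ)))).card

/-- The conclusion of the crux for ONE system `f` of `k` polynomials. [folklore] -/
def LayerConclusion (k : ℕ) (f : Fin k → ℤ[X]) : Prop :=
  ∀ ε : ℝ, 0 < ε → ∃ δ : ℝ, 0 < δ ∧ δ ≤ 1 / 4 ∧ ∀ᶠ x : ℕ in atTop,
    (roughCount f δ x : ℝ) ≤ (polyPrimeCount f x : ℝ) + ε * (x : ℝ) / Real.log x ^ k

/-- The crux is `∀ systems, LayerConclusion`. [folklore] -/
theorem crux_iff :
    BalancedSemiprimeLayer ↔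
      ∀ (k : ℕ) (f : Fin k → ℤ[X]), IsBatemanHornSystem f → LayerConclusion k f :=
  Iff.rfl

/-! ### Witness systems -/

/-- `#{n < p : p ∣ n} = 1` for a prime `p`. [folklore] -/
theorem card_filter_range_dvd {p : ℕ} (hp : p.Prime) :
    #((range p).filter (fun n : ℕ => p ∣ n)) = 1 := by
  rw [Finset.card_eq_one]
  refine ⟨0, ?_⟩
  ext n
  simp only [mem_filter, mem_range, mem_singleton]
  constructor
  · rintro ⟨hn, hpn⟩
    exact Nat.eq_zero_of_dvd_of_lt hpn hn
  · rintro rfl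
    exact ⟨hp.pos, dvd_zero p⟩

/-- `ω_{(X)}(p) = 1`. [folklore] -/
theorem polyRootCountMod_X {p : ℕ} (hp : p.Prime) :
    polyRootCountMod ![(X : ℤ[X])] p = 1 := by
  unfold polyRootCountMod
  have h : ∀ n : ℕ, ((p : ℤ) ∣ ∏ i, (![(X : ℤ[X])] i).eval (n : ℤ)) ↔ p ∣ n := by
    intro n
    simp only [Fin.prod_univ_one, Matrix.cons_val_fin_one, eval_X]
    exact Int.natCast_dvd_natCast
  simp_rw [h]
  exact card_filter_range_dvd hp

/-- `ω_{(X,X)}(p) = 1` and `ω_{(X²)}(p) = 1`: `p ∣ n·n ↔ p ∣ n`. [folklore] -/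
theorem card_filter_range_dvd_mul_self {p : ℕ} (hp : p.Prime) :
    #((range p).filter (fun n : ℕ => (p : ℤ) ∣ (n : ℤ) * (n : ℤ))) = 1 := by
  have h : ∀ n : ℕ, ((p : ℤ) ∣ (n : ℤ) * (n : ℤ)) ↔ p ∣ n := by
    intro n
    rw [← Nat.cast_mul, Int.natCast_dvd_natCast]
    exact ⟨fun h => (hp.dvd_mul.mp h).elim id id, fun h => h.mul_right n⟩
  simp_rw [h]
  exact card_filter_range_dvd hp

/-- The system `(X)` is a Bateman–Horn system. [folklore] -/
theorem isBatemanHornSystem_X : IsBatemanHornSystem ![(X : ℤ[X])] where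
  irreducible i := by
    fin_cases i
    exact irreducible_X
  leadingCoeff_pos i := by
    fin_cases i
    simp
  pairwise_not_associated := Subsingleton.pairwise
  hasNoFixedPrimeDivisor p hp := by
    rw [polyRootCountMod_X hp]
    exact hp.one_lt

/-- `IsBatemanHornSystem` minus `pairwise_not_associated`. [folklore] -/
structure IsSystemWithoutNotAssociated {k : ℕ} (f : Fin k → ℤ[X]) : Prop where
  irreducible : ∀ i, Irreducible (f i)
  leadingCoeff_pos : ∀ i, 0 < (f i).leadingCoeff
  hasNoFixedPrimeDivisor : HasNoFixedPrimeDivisor f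

/-- `IsBatemanHornSystem` minus `irreducible`. [folklore] -/
structure IsSystemWithoutIrreducible {k : ℕ} (f : Fin k → ℤ[X]) : Prop where
  leadingCoeff_pos : ∀ i, 0 < (f i).leadingCoeff
  pairwise_not_associated : Pairwise fun i j => ¬Associated (f i) (f j)
  hasNoFixedPrimeDivisor : HasNoFixedPrimeDivisor f

/-- `IsBatemanHornSystem` minus `hasNoFixedPrimeDivisor`. [folklore] -/
structure IsSystemWithoutNoFixedPrimeDivisor {k : ℕ} (f : Fin k → ℤ[X]) : Prop where
  irreducible : ∀ i, Irreducible (f i)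
  leadingCoeff_pos : ∀ i, 0 < (f i).leadingCoeff
  pairwise_not_associated : Pairwise fun i j => ¬Associated (f i) (f j)

/-- `IsBatemanHornSystem` minus `leadingCoeff_pos`. [folklore] -/
structure IsSystemWithoutLeadingCoeffPos {k : ℕ} (f : Fin k → ℤ[X]) : Prop where
  irreducible : ∀ i, Irreducible (f i)
  pairwise_not_associated : Pairwise fun i j => ¬Associated (f i) (f j)
  hasNoFixedPrimeDivisor : HasNoFixedPrimeDivisor f

/-- The duplicated system `(X, X)` satisfies everything but `pairwise_not_associated`. [folklore] -/
theorem isSystemWithoutNotAssociated_X_X : IsSystemWithoutNotAssociated ![(X : ℤ[X]), X] where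
  irreducible i := by
    fin_cases i <;> exact irreducible_X
  leadingCoeff_pos i := by
    fin_cases i <;> simp
  hasNoFixedPrimeDivisor p hp := by
    unfold polyRootCountMod
    simp only [Fin.prod_univ_two, Matrix.cons_val_zero, Matrix.cons_val_one, eval_X]
    rw [card_filter_range_dvd_mul_self hp]
    exact hp.one_lt

/-- The system `(X²)` satisfies everything but `irreducible`. [folklore] -/
theorem isSystemWithoutIrreducible_X_sq : IsSystemWithoutIrreducible ![(X ^ 2 : ℤ[X])] where
  leadingCoeff_pos i := by
    fin_cases i
    simp
  pairwise_not_associated := Subsingleton.pairwise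
  hasNoFixedPrimeDivisor p hp := by
    unfold polyRootCountMod
    simp only [Fin.prod_univ_one, Matrix.cons_val_fin_one, eval_pow, eval_X]
    simp only [sq]
    rw [card_filter_range_dvd_mul_self hp]
    exact hp.one_lt

/-- The constant `2` is irreducible in `ℤ[X]`. [folklore] -/
theorem irreducible_C_two : Irreducible (C (2 : ℤ) : ℤ[X]) :=
  (Polynomial.prime_C_iff.mpr Int.prime_two).irreducible

/-- The system `(2, X)` satisfies everything but `hasNoFixedPrimeDivisor`. [folklore] -/
theorem isSystemWithoutNoFixedPrimeDivisor_two_X :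
    IsSystemWithoutNoFixedPrimeDivisor ![C (2 : ℤ), (X : ℤ[X])] where
  irreducible i := by
    fin_cases i
    · exact irreducible_C_two
    · exact irreducible_X
  leadingCoeff_pos i := by
    fin_cases i
    · show 0 < (C (2 : ℤ) : ℤ[X]).leadingCoeff
      rw [leadingCoeff_C]; norm_num
    · show 0 < (X : ℤ[X]).leadingCoeff
      rw [leadingCoeff_X]; norm_num
  pairwise_not_associated i j hij := by
    have hdeg : (C (2 : ℤ) : ℤ[X]).degree ≠ (X : ℤ[X]).degree := by
      rw [degree_C (by norm_num), degree_X]; decide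
    fin_cases i <;> fin_cases j
    · exact absurd rfl hij
    · intro h; exact hdeg (degree_eq_degree_of_associated h)
    · intro h; exact hdeg (degree_eq_degree_of_associated h).symm
    · exact absurd rfl hij

/-! ### The counts for the witness systems -/

/-- The crux's sifting condition on an integer coordinate is roughness. [folklore] -/
theorem filter_rough_eq_roughIcc (N x : ℕ) :
    (Icc 1 x).filter (fun n : ℕ => 0 < (n : ℤ) ∧ ∀ p ∈ range N, p.Prime → ¬ ((p : ℤ) ∣ (n : ℤ))) =
      roughIcc N x := by
  unfold roughIcc
  refine filter_congr fun n hn => ?_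
  rw [mem_Icc] at hn
  constructor
  · rintro ⟨-, h⟩ p hp
    have hp' := Nat.prime_of_mem_primeFactors hp
    have hpn := Nat.dvd_of_mem_primeFactors hp
    by_contra hlt
    exact h p (mem_range.mpr (not_le.mp hlt)) hp' (Int.natCast_dvd_natCast.mpr hpn)
  · intro h
    refine ⟨by exact_mod_cast hn.1, fun p hp hpp hpn => ?_⟩
    have hmem : p ∈ n.primeFactors :=
      Nat.mem_primeFactors.mpr ⟨hpp, Int.natCast_dvd_natCast.mp hpn, by omega⟩
    exact absurd (h p hmem) (not_le.mpr (mem_range.mp hp))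

/-- `Φ_{(X)}(x, δ) = Φ(x, x^{(1−δ)/2})`. [folklore] -/
theorem roughCount_X (δ : ℝ) (x : ℕ) :
    roughCount ![(X : ℤ[X])] δ x = #(roughIcc ⌈(x : ℝ) ^ ((1 - δ) / 2)⌉₊ x) := by
  unfold roughCount
  rw [← filter_rough_eq_roughIcc]
  congr 1
  refine filter_congr fun n _ => ?_
  simp only [Fin.forall_fin_one, Matrix.cons_val_fin_one, eval_X, natDegree_X, Nat.cast_one, one_mul]

/-- `Φ_{(X,X)}(x, δ) = Φ(x, x^{(1−δ)/2})`. [folklore] -/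
theorem roughCount_X_X (δ : ℝ) (x : ℕ) :
    roughCount ![(X : ℤ[X]), X] δ x = #(roughIcc ⌈(x : ℝ) ^ ((1 - δ) / 2)⌉₊ x) := by
  unfold roughCount
  rw [← filter_rough_eq_roughIcc]
  congr 1
  refine filter_congr fun n _ => ?_
  simp only [Fin.forall_fin_two, Matrix.cons_val_zero, Matrix.cons_val_one, eval_X, natDegree_X,
    Nat.cast_one, one_mul, and_self]

/-- `Φ_{(2,X)}(x, δ) = Φ(x, x^{(1−δ)/2})`: the constant coordinate is sifted by no prime. [folklore] -/
theorem roughCount_two_X (δ : ℝ) (x : ℕ) :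
    roughCount ![C (2 : ℤ), (X : ℤ[X])] δ x = #(roughIcc ⌈(x : ℝ) ^ ((1 - δ) / 2)⌉₊ x) := by
  unfold roughCount
  rw [← filter_rough_eq_roughIcc]
  congr 1
  refine filter_congr fun n _ => ?_
  simp only [Fin.forall_fin_two, Matrix.cons_val_zero, Matrix.cons_val_one, eval_X, natDegree_X,
    Nat.cast_one, one_mul, eval_C, natDegree_C, CharP.cast_eq_zero, zero_mul, zero_div,
    Real.rpow_zero, Nat.ceil_one, Finset.range_one, Finset.mem_singleton, forall_eq,
    Nat.not_prime_zero, IsEmpty.forall_iff, and_true]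
  simp

/-- `Φ_{(X²)}(x, δ) = Φ(x, x^{1−δ})`. [folklore] -/
theorem roughCount_X_sq (δ : ℝ) (x : ℕ) :
    roughCount ![(X ^ 2 : ℤ[X])] δ x = #(roughIcc ⌈(x : ℝ) ^ (1 - δ)⌉₊ x) := by
  unfold roughCount
  rw [← filter_rough_eq_roughIcc]
  congr 1
  refine filter_congr fun n hn => ?_
  rw [mem_Icc] at hn
  simp only [Fin.forall_fin_one, Matrix.cons_val_fin_one, eval_pow, eval_X, natDegree_pow,
    natDegree_X, mul_one, Nat.cast_ofNat]
  have he : (2 : ℝ) * (1 - δ) / 2 = 1 - δ := by ring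
  rw [he]
  have hn0 : (0 : ℤ) < n := by exact_mod_cast hn.1
  have hdvd : ∀ p : ℕ, p.Prime → (((p : ℤ) ∣ (n : ℤ) ^ 2) ↔ ((p : ℤ) ∣ (n : ℤ))) := by
    intro p hp
    rw [← Nat.cast_pow, Int.natCast_dvd_natCast, Int.natCast_dvd_natCast]
    exact ⟨hp.dvd_of_dvd_pow, fun h => h.trans (dvd_pow_self n two_ne_zero)⟩
  constructor
  · rintro ⟨-, h⟩
    exact ⟨hn0, fun p hp hpp => (hdvd p hpp).not.mp (h p hp hpp)⟩
  · rintro ⟨-, h⟩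
    exact ⟨by positivity, fun p hp hpp => (hdvd p hpp).not.mpr (h p hp hpp)⟩

/-- `P_{(X)}(x) = π(x)`. [folklore] -/
theorem polyPrimeCount_X (x : ℕ) : polyPrimeCount ![(X : ℤ[X])] x = Nat.primeCounting x := by
  rw [← Nat.primesLE_card_eq_primeCounting, Nat.primesLE_eq_filter_range]
  unfold polyPrimeCount
  congr 1
  ext n
  simp only [mem_filter, Fin.forall_fin_one, Matrix.cons_val_fin_one, eval_X, Int.toNat_natCast]
  exact and_congr_right fun _ => ⟨fun h => h.2, fun h => ⟨by exact_mod_cast h.pos, h⟩⟩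

/-- `P_{(X,X)}(x) = π(x)`. [folklore] -/
theorem polyPrimeCount_X_X (x : ℕ) : polyPrimeCount ![(X : ℤ[X]), X] x = Nat.primeCounting x := by
  rw [← Nat.primesLE_card_eq_primeCounting, Nat.primesLE_eq_filter_range]
  unfold polyPrimeCount
  congr 1
  ext n
  simp only [mem_filter, Fin.forall_fin_two, Matrix.cons_val_zero, Matrix.cons_val_one, eval_X,
    Int.toNat_natCast, and_self]
  exact and_congr_right fun _ => ⟨fun h => h.2, fun h => ⟨by exact_mod_cast h.pos, h⟩⟩

/-- `P_{(2,X)}(x) = π(x)`. [folklore] -/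
theorem polyPrimeCount_two_X (x : ℕ) :
    polyPrimeCount ![C (2 : ℤ), (X : ℤ[X])] x = Nat.primeCounting x := by
  rw [← Nat.primesLE_card_eq_primeCounting, Nat.primesLE_eq_filter_range]
  unfold polyPrimeCount
  congr 1
  ext n
  simp only [mem_filter, Fin.forall_fin_two, Matrix.cons_val_zero, Matrix.cons_val_one, eval_X,
    eval_C, Int.toNat_natCast]
  refine and_congr_right fun _ => ⟨fun h => h.2.2, fun h => ⟨⟨by norm_num, by decide⟩, by exact_mod_cast h.pos, h⟩⟩

/-- `P_{(X²)}(x) = 0`: a square is never prime. [folklore] -/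
theorem polyPrimeCount_X_sq (x : ℕ) : polyPrimeCount ![(X ^ 2 : ℤ[X])] x = 0 := by
  unfold polyPrimeCount
  rw [Finset.card_eq_zero, Finset.eq_empty_iff_forall_notMem]
  intro n hn
  simp only [mem_filter, Fin.forall_fin_one, Matrix.cons_val_fin_one, eval_pow, eval_X] at hn
  have h := hn.2.2
  rw [← Nat.cast_pow, Int.toNat_natCast, sq] at h
  rcases eq_or_ne n 1 with rfl | hn1
  · exact Nat.not_prime_one (by simpa using h)
  · exact Nat.not_prime_mul hn1 hn1 h

/-! ### The analytic core: `Φ(x, x^θ) · log x / x → ω(1/θ)/θ` and the prime number theorem -/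

/-- The prime number theorem along `ℕ`: `π(x) log x / x → 1` (from the tree's PROVED
`Literature.NumberTheory.LFunctions.primeCounting_isEquivalent_holds`). [folklore] -/
theorem tendsto_primeCounting_mul_log_div_nat :
    Tendsto (fun x : ℕ => (Nat.primeCounting x : ℝ) * Real.log x / x) atTop (𝓝 1) := by
  have h := Literature.NumberTheory.LFunctions.primeCounting_isEquivalent_holds
  have hne : ∀ᶠ x : ℝ in atTop, x / Real.log x ≠ 0 := by
    filter_upwards [eventually_gt_atTop 1] with x hx
    exact div_ne_zero (by linarith) (Real.log_pos hx).ne'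
  have h2 := ((isEquivalent_iff_tendsto_one hne).mp h).comp tendsto_natCast_atTop_atTop
  refine h2.congr' ?_
  filter_upwards [eventually_gt_atTop 1] with x hx
  have hx' : (1 : ℝ) < x := by exact_mod_cast hx
  have hlog : Real.log x ≠ 0 := (Real.log_pos hx').ne'
  have hx0 : (x : ℝ) ≠ 0 := by positivity
  simp only [Function.comp_apply, Pi.div_apply, Nat.floor_natCast]
  field_simp

/-- **Core asymptotic** (the integer Buchstab law of the tree, PROVED
`exists_abs_card_roughIcc_sub_main_le_of_rpow`, read as a limit): for `1/3 ≤ θ < 1`,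
`Φ(x, x^θ) · log x / x → ω(1/θ)/θ = u ω(u)`, `u = 1/θ`. [cite: Lichtman2025LinearSieve, Lemma 6.1] -/
theorem tendsto_card_roughIcc_mul_log_div {θ : ℝ} (hθ : 1 / 3 ≤ θ) (hθ1 : θ < 1) :
    Tendsto (fun x : ℕ => (#(roughIcc ⌈(x : ℝ) ^ θ⌉₊ x) : ℝ) * Real.log x / x) atTop
      (𝓝 (buchstabOmega (1 / θ) / θ)) := by
  obtain ⟨C, hC0, hC⟩ := exists_abs_card_roughIcc_sub_main_le_of_rpow 3
  have hθ0 : 0 < θ := by linarith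
  set L : ℝ := buchstabOmega (1 / θ) / θ with hL
  -- the error majorant tends to `0`
  have hmaj : Tendsto (fun x : ℕ => (x : ℝ) ^ (θ - 1) / θ + C / (θ ^ 2 * Real.log x)) atTop (𝓝 0) := by
    have h1 : Tendsto (fun x : ℕ => (x : ℝ) ^ (θ - 1)) atTop (𝓝 0) := by
      have := (tendsto_rpow_neg_atTop (by linarith : 0 < 1 - θ)).comp tendsto_natCast_atTop_atTop
      refine this.congr' (Eventually.of_forall fun x => ?_)
      simp only [Function.comp_apply]
      congr 1
      ring
    have h2 : Tendsto (fun x : ℕ => C / (θ ^ 2 * Real.log x)) atTop (𝓝 0) := by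
      have hl : Tendsto (fun x : ℕ => θ ^ 2 * Real.log x) atTop atTop :=
        Tendsto.const_mul_atTop (by positivity)
          (Real.tendsto_log_atTop.comp tendsto_natCast_atTop_atTop)
      have := hl.inv_tendsto_atTop.const_mul C
      rw [mul_zero] at this
      refine this.congr' (Eventually.of_forall fun x => ?_)
      simp [div_eq_mul_inv]
    simpa using (h1.div_const θ).add h2
  -- the eventual bound `|Φ log x / x − L| ≤ x^{θ−1}/θ + C/(θ² log x)`
  have hbound : ∀ᶠ x : ℕ in atTop,
      |(#(roughIcc ⌈(x : ℝ) ^ θ⌉₊ x) : ℝ) * Real.log x / x - L| ≤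
        (x : ℝ) ^ (θ - 1) / θ + C / (θ ^ 2 * Real.log x) := by
    have hy : Tendsto (fun x : ℕ => (x : ℝ) ^ θ) atTop atTop :=
      (tendsto_rpow_atTop hθ0).comp tendsto_natCast_atTop_atTop
    filter_upwards [hy.eventually_ge_atTop 2, eventually_ge_atTop 2] with x hx2 hx
    have hxR : (2 : ℝ) ≤ x := by exact_mod_cast hx
    have hx0 : (0 : ℝ) < x := by linarith
    have hx1 : (1 : ℝ) ≤ x := by linarith
    have hlogx : 0 < Real.log x := Real.log_pos (by linarith)
    have hyx : (x : ℝ) ^ θ ≤ x := by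
      calc (x : ℝ) ^ θ ≤ (x : ℝ) ^ (1 : ℝ) := Real.rpow_le_rpow_of_exponent_le hx1 hθ1.le
        _ = x := Real.rpow_one _
    have hxy3 : (x : ℝ) ≤ ((x : ℝ) ^ θ) ^ (3 : ℝ) := by
      rw [← Real.rpow_mul hx0.le]
      calc (x : ℝ) = (x : ℝ) ^ (1 : ℝ) := (Real.rpow_one _).symm
        _ ≤ (x : ℝ) ^ (θ * 3) := Real.rpow_le_rpow_of_exponent_le hx1 (by linarith)
    have hlogy : Real.log ((x : ℝ) ^ θ) = θ * Real.log x := Real.log_rpow hx0 θ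
    have hu : Real.log x / Real.log ((x : ℝ) ^ θ) = 1 / θ := by
      rw [hlogy]
      field_simp
    have h := hC x ((x : ℝ) ^ θ) hx2 hyx hxy3
    rw [Nat.floor_natCast, hu, hlogy] at h
    have hkey : (#(roughIcc ⌈(x : ℝ) ^ θ⌉₊ x) : ℝ) * Real.log x / x - L =
        ((#(roughIcc ⌈(x : ℝ) ^ θ⌉₊ x) : ℝ) -
            (x * buchstabOmega (1 / θ) - (x : ℝ) ^ θ) / (θ * Real.log x)) * (Real.log x / x) -
          (x : ℝ) ^ θ / (θ * x) := by
      rw [hL]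
      field_simp
      ring
    rw [hkey]
    have hlx : 0 < Real.log x / x := by positivity
    calc |((#(roughIcc ⌈(x : ℝ) ^ θ⌉₊ x) : ℝ) -
              (x * buchstabOmega (1 / θ) - (x : ℝ) ^ θ) / (θ * Real.log x)) * (Real.log x / x) -
            (x : ℝ) ^ θ / (θ * x)|
        ≤ |((#(roughIcc ⌈(x : ℝ) ^ θ⌉₊ x) : ℝ) -
              (x * buchstabOmega (1 / θ) - (x : ℝ) ^ θ) / (θ * Real.log x)) * (Real.log x / x)| +
            |(x : ℝ) ^ θ / (θ * x)| := abs_sub _ _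
      _ = |(#(roughIcc ⌈(x : ℝ) ^ θ⌉₊ x) : ℝ) -
              (x * buchstabOmega (1 / θ) - (x : ℝ) ^ θ) / (θ * Real.log x)| * (Real.log x / x) +
            (x : ℝ) ^ θ / (θ * x) := by
          rw [abs_mul, abs_of_pos hlx,
            abs_of_nonneg (div_nonneg (Real.rpow_nonneg hx0.le θ) (mul_pos hθ0 hx0).le)]
      _ ≤ C * x / (θ * Real.log x) ^ 2 * (Real.log x / x) + (x : ℝ) ^ θ / (θ * x) := by gcongr
      _ = (x : ℝ) ^ (θ - 1) / θ + C / (θ ^ 2 * Real.log x) := by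
          rw [Real.rpow_sub_one hx0.ne']
          field_simp
          ring
  rw [tendsto_iff_norm_sub_tendsto_zero]
  refine squeeze_zero' (Eventually.of_forall fun x => norm_nonneg _) ?_ hmaj
  filter_upwards [hbound] with x hx
  simpa only [Real.norm_eq_abs] using hx

/-- **The `(X)` rough count**: `Φ_{(X)}(x, δ) · log x / x → 1 + log((1+δ)/(1−δ))` for
`0 ≤ δ ≤ 1/4` (`u = 2/(1−δ) ∈ [2, 8/3]`, `u ω(u) = 1 + log(u − 1)`). [folklore] -/
theorem tendsto_roughCount_X {δ : ℝ} (hδ0 : 0 ≤ δ) (hδ : δ ≤ 1 / 4) :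
    Tendsto (fun x : ℕ => (roughCount ![(X : ℤ[X])] δ x : ℝ) * Real.log x / x) atTop
      (𝓝 (1 + Real.log ((1 + δ) / (1 - δ)))) := by
  have hθ : (1 : ℝ) / 3 ≤ (1 - δ) / 2 := by linarith
  have hθ1 : (1 - δ) / 2 < 1 := by linarith
  have h := tendsto_card_roughIcc_mul_log_div hθ hθ1
  have hval : buchstabOmega (1 / ((1 - δ) / 2)) / ((1 - δ) / 2) =
      1 + Real.log ((1 + δ) / (1 - δ)) := by
    have hu2 : (2 : ℝ) ≤ 1 / ((1 - δ) / 2) := by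
      rw [le_div_iff₀ (by linarith)]; linarith
    have hu3 : 1 / ((1 - δ) / 2) ≤ 3 := by
      rw [div_le_iff₀ (by linarith)]; linarith
    rw [buchstabOmega_eq_of_mem_Icc_two_three hu2 hu3]
    have hne : (1 : ℝ) - δ ≠ 0 := ne_of_gt (by linarith)
    have h1 : 1 / ((1 - δ) / 2) - 1 = (1 + δ) / (1 - δ) := by
      field_simp
      ring
    rw [h1]
    field_simp
  rw [hval] at h
  simpa only [roughCount_X] using h

/-- **The `(X²)` rough count**: `Φ_{(X²)}(x, δ) · log x / x → 1` for `0 < δ ≤ 1/4`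
(`Φ_{(X²)}(x, δ) = Φ(x, x^{1−δ}) = 1 + π(x) − π(x^{1−δ})`, `u = 1/(1−δ) ∈ (1, 4/3]`). [folklore] -/
theorem tendsto_roughCount_X_sq {δ : ℝ} (hδ0 : 0 < δ) (hδ : δ ≤ 1 / 4) :
    Tendsto (fun x : ℕ => (roughCount ![(X ^ 2 : ℤ[X])] δ x : ℝ) * Real.log x / x) atTop (𝓝 1) := by
  have hθ : (1 : ℝ) / 3 ≤ 1 - δ := by linarith
  have hθ1 : 1 - δ < 1 := by linarith
  have h := tendsto_card_roughIcc_mul_log_div hθ hθ1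
  have hval : buchstabOmega (1 / (1 - δ)) / (1 - δ) = 1 := by
    have hu1 : (1 : ℝ) ≤ 1 / (1 - δ) := by
      rw [le_div_iff₀ (by linarith)]; linarith
    have hu2 : 1 / (1 - δ) ≤ 2 := by
      rw [div_le_iff₀ (by linarith)]; linarith
    rw [buchstabOmega_eq_inv hu1 hu2]
    have hne : (1 : ℝ) - δ ≠ 0 := ne_of_gt (by linarith)
    field_simp
  rw [hval] at h
  simpa only [roughCount_X_sq] using h

/-- **The `(X)`-layer asymptotic**: `(Φ_{(X)}(x,δ) − P_{(X)}(x)) · log x / x → log((1+δ)/(1−δ))`,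
i.e. the balanced-semiprime layer of `(X)` is `∼ log((1+δ)/(1−δ)) · x/log x ≈ 2δ x/log x`
(`= (uω(u) − 1) x/log x`: the `k = 1`, `f = (X)` instance of RoughValueLaw + PNT). [folklore] -/
theorem tendsto_layer_X {δ : ℝ} (hδ0 : 0 ≤ δ) (hδ : δ ≤ 1 / 4) :
    Tendsto (fun x : ℕ => ((roughCount ![(X : ℤ[X])] δ x : ℝ) -
        (polyPrimeCount ![(X : ℤ[X])] x : ℝ)) * Real.log x / x) atTop
      (𝓝 (Real.log ((1 + δ) / (1 - δ)))) := by
  have h := (tendsto_roughCount_X hδ0 hδ).sub tendsto_primeCounting_mul_log_div_nat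
  rw [add_sub_cancel_left] at h
  refine h.congr' (Eventually.of_forall fun x => ?_)
  simp only [polyPrimeCount_X]
  ring

/-! ### From limits to eventual inequalities -/

/-- `a·log x/x → L`, `c < L` ⇒ eventually `c·x/log x < a`. [folklore] -/
theorem eventually_mul_div_log_lt {a : ℕ → ℝ} {L c : ℝ}
    (h : Tendsto (fun x : ℕ => a x * Real.log x / x) atTop (𝓝 L)) (hc : c < L) :
    ∀ᶠ x : ℕ in atTop, c * x / Real.log x < a x := by
  filter_upwards [h.eventually (eventually_gt_nhds hc), eventually_gt_atTop 1] with x hx hx1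
  have hx' : (1 : ℝ) < x := by exact_mod_cast hx1
  have hlog : 0 < Real.log x := Real.log_pos hx'
  have hx0 : (0 : ℝ) < x := by linarith
  rw [lt_div_iff₀ hx0] at hx
  rw [div_lt_iff₀ hlog]
  linarith

/-- `a·log x/x → L`, `L < c` ⇒ eventually `a < c·x/log x`. [folklore] -/
theorem eventually_lt_mul_div_log {a : ℕ → ℝ} {L c : ℝ}
    (h : Tendsto (fun x : ℕ => a x * Real.log x / x) atTop (𝓝 L)) (hc : L < c) :
    ∀ᶠ x : ℕ in atTop, a x < c * x / Real.log x := by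
  filter_upwards [h.eventually (eventually_lt_nhds hc), eventually_gt_atTop 1] with x hx hx1
  have hx' : (1 : ℝ) < x := by exact_mod_cast hx1
  have hlog : 0 < Real.log x := Real.log_pos hx'
  have hx0 : (0 : ℝ) < x := by linarith
  rw [div_lt_iff₀ hx0] at hx
  rw [lt_div_iff₀ hlog]
  linarith

/-- `a·log x/x → L > 0` ⇒ `a` beats every `ε·x/(log x)^m`, `m ≥ 2`, eventually. [folklore] -/
theorem eventually_mul_div_log_pow_lt {a : ℕ → ℝ} {L : ℝ}
    (h : Tendsto (fun x : ℕ => a x * Real.log x / x) atTop (𝓝 L)) (hL : 0 < L) (ε : ℝ) {m : ℕ}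
    (hm : 2 ≤ m) : ∀ᶠ x : ℕ in atTop, ε * x / Real.log x ^ m < a x := by
  have h1 := eventually_mul_div_log_lt h (half_lt_self hL)
  have hlog : Tendsto (fun x : ℕ => Real.log x) atTop atTop :=
    Real.tendsto_log_atTop.comp tendsto_natCast_atTop_atTop
  filter_upwards [h1, hlog.eventually_ge_atTop (max 1 (2 * ε / L)), eventually_gt_atTop 1]
    with x hx hlx hx1
  have hx' : (1 : ℝ) < x := by exact_mod_cast hx1
  have hx0 : (0 : ℝ) < x := by linarith
  have hl1 : 1 ≤ Real.log x := le_trans (le_max_left _ _) hlx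
  have hl2 : 2 * ε / L ≤ Real.log x := le_trans (le_max_right _ _) hlx
  have hlpos : 0 < Real.log x := by linarith
  refine lt_of_le_of_lt ?_ hx
  rw [div_le_div_iff₀ (by positivity) hlpos]
  rw [div_le_iff₀ hL] at hl2
  have hε : ε * Real.log x ≤ L / 2 * Real.log x ^ m :=
    calc ε * Real.log x ≤ (L / 2 * Real.log x) * Real.log x := by
          apply mul_le_mul_of_nonneg_right _ hlpos.le
          linarith
      _ = L / 2 * Real.log x ^ 2 := by ring
      _ ≤ L / 2 * Real.log x ^ m :=
          mul_le_mul_of_nonneg_left (pow_le_pow_right₀ hl1 hm) (by linarith)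
  nlinarith [mul_le_mul_of_nonneg_left hε hx0.le]

/-! ### (b) Tightness of the crux at the system `(X)` -/

/-- `δ ≤ log((1+δ)/(1−δ))` for `0 ≤ δ < 1` (indeed `2δ ≤ …`; this much suffices here). [folklore] -/
theorem delta_le_log_ratio {δ : ℝ} (hδ0 : 0 ≤ δ) (hδ1 : δ < 1) :
    δ ≤ Real.log ((1 + δ) / (1 - δ)) := by
  have hpos : 0 < (1 + δ) / (1 - δ) := div_pos (by linarith) (by linarith)
  have h := Real.one_sub_inv_le_log_of_pos hpos
  have h2 : δ ≤ 1 - ((1 + δ) / (1 - δ))⁻¹ := by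
    rw [inv_div, le_sub_iff_add_le, ← le_sub_iff_add_le', div_le_iff₀ (by linarith)]
    nlinarith
  linarith

/-- The sharp form `2δ ≤ log((1+δ)/(1−δ)) = 2 artanh δ` (first term of the artanh series,
Mathlib's `Real.hasSum_log_sub_log_of_abs_lt_one`). [folklore] -/
theorem two_mul_le_log_ratio {δ : ℝ} (hδ0 : 0 ≤ δ) (hδ1 : δ < 1) :
    2 * δ ≤ Real.log ((1 + δ) / (1 - δ)) := by
  have h := Real.hasSum_log_sub_log_of_abs_lt_one (show |δ| < 1 by rw [abs_of_nonneg hδ0]; exact hδ1)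
  have h2 := sum_le_hasSum {0} (fun i _ => by positivity) h
  rw [Finset.sum_singleton] at h2
  norm_num at h2
  rw [Real.log_div (by linarith) (by linarith)]
  linarith

/-- `0 < log((1+δ)/(1−δ))` for `0 < δ < 1`. [folklore] -/
theorem log_ratio_pos {δ : ℝ} (hδ0 : 0 < δ) (hδ1 : δ < 1) : 0 < Real.log ((1 + δ) / (1 - δ)) :=
  Real.log_pos (by rw [one_lt_div (by linarith)]; linarith)

/-- **Lower bound for the `(X)`-layer**: for every `c < log((1+δ)/(1−δ))`, eventually
`Φ_{(X)}(x, δ) > P_{(X)}(x) + c·x/log x`. [folklore] -/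
theorem layer_X_eventually_gt {δ c : ℝ} (hδ0 : 0 ≤ δ) (hδ : δ ≤ 1 / 4)
    (hc : c < Real.log ((1 + δ) / (1 - δ))) :
    ∀ᶠ x : ℕ in atTop, (polyPrimeCount ![(X : ℤ[X])] x : ℝ) + c * x / Real.log x <
      roughCount ![(X : ℤ[X])] δ x := by
  filter_upwards [eventually_mul_div_log_lt (tendsto_layer_X hδ0 hδ) hc] with x hx
  linarith

/-- **Upper bound for the `(X)`-layer**: for every `c > log((1+δ)/(1−δ))`, eventually
`Φ_{(X)}(x, δ) < P_{(X)}(x) + c·x/log x`. [folklore] -/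
theorem layer_X_eventually_lt {δ c : ℝ} (hδ0 : 0 ≤ δ) (hδ : δ ≤ 1 / 4)
    (hc : Real.log ((1 + δ) / (1 - δ)) < c) :
    ∀ᶠ x : ℕ in atTop, (roughCount ![(X : ℤ[X])] δ x : ℝ) <
      (polyPrimeCount ![(X : ℤ[X])] x : ℝ) + c * x / Real.log x := by
  filter_upwards [eventually_lt_mul_div_log (tendsto_layer_X hδ0 hδ) hc] with x hx
  linarith

/-- **Tightness (`crux_tight_at_X`)**: if the crux inequality holds eventually for `(X)` with the
pair `(ε, δ)`, then `log((1+δ)/(1−δ)) ≤ ε`; in particular `δ ≤ ε` — the admissible `δ(ε)` is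
`O(ε)` and the tolerance `ε·x/(log x)^k` cannot be lowered in order. [folklore] -/
theorem log_ratio_le_of_eventually_layer_X {δ ε : ℝ} (hδ0 : 0 ≤ δ) (hδ : δ ≤ 1 / 4)
    (h : ∀ᶠ x : ℕ in atTop, (roughCount ![(X : ℤ[X])] δ x : ℝ) ≤
      (polyPrimeCount ![(X : ℤ[X])] x : ℝ) + ε * x / Real.log x) :
    Real.log ((1 + δ) / (1 - δ)) ≤ ε := by
  by_contra hlt
  push Not at hlt
  obtain ⟨x, hx1, hx2⟩ := (h.and (layer_X_eventually_gt hδ0 hδ hlt)).exists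
  linarith

/-- Corollary: `δ ≤ ε` for every admissible pair at `(X)`. [folklore] -/
theorem delta_le_of_eventually_layer_X {δ ε : ℝ} (hδ0 : 0 ≤ δ) (hδ : δ ≤ 1 / 4)
    (h : ∀ᶠ x : ℕ in atTop, (roughCount ![(X : ℤ[X])] δ x : ℝ) ≤
      (polyPrimeCount ![(X : ℤ[X])] x : ℝ) + ε * x / Real.log x) :
    δ ≤ ε :=
  (delta_le_log_ratio hδ0 (by linarith)).trans (log_ratio_le_of_eventually_layer_X hδ0 hδ h)

/-- Sharp corollary: `2δ ≤ ε` for every admissible pair at `(X)` — exactly the heuristic threshold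
`2kδ·(C(f)/∏deg fᵢ) ≤ ε` at `k = 1`, `C(X) = 1`. [folklore] -/
theorem two_mul_delta_le_of_eventually_layer_X {δ ε : ℝ} (hδ0 : 0 ≤ δ) (hδ : δ ≤ 1 / 4)
    (h : ∀ᶠ x : ℕ in atTop, (roughCount ![(X : ℤ[X])] δ x : ℝ) ≤
      (polyPrimeCount ![(X : ℤ[X])] x : ℝ) + ε * x / Real.log x) :
    2 * δ ≤ ε :=
  (two_mul_le_log_ratio hδ0 (by linarith)).trans (log_ratio_le_of_eventually_layer_X hδ0 hδ h)

/-- **The crux HOLDS at `(X)`** with the explicit choice `δ(ε) = min (1/4) (ε/4)`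
(`log((1+δ)/(1−δ)) ≤ 2δ/(1−δ) ≤ (8/3)δ < ε`): the positive instance `k = 1`, `f = (X)` —
template for the all-linear layer. [folklore] -/
theorem layerConclusion_X : LayerConclusion 1 ![(X : ℤ[X])] := by
  intro ε hε
  refine ⟨min (1 / 4) (ε / 4), by positivity, min_le_left _ _, ?_⟩
  set δ : ℝ := min (1 / 4) (ε / 4) with hδ_def
  have hδ0 : 0 < δ := by positivity
  have hδ : δ ≤ 1 / 4 := min_le_left _ _
  have hδε : δ ≤ ε / 4 := min_le_right _ _
  -- `log((1+δ)/(1−δ)) ≤ (1+δ)/(1−δ) − 1 = 2δ/(1−δ) ≤ (8/3) δ < ε`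
  have hlog : Real.log ((1 + δ) / (1 - δ)) < ε := by
    have h1 := Real.log_le_sub_one_of_pos (show 0 < (1 + δ) / (1 - δ) from div_pos (by linarith) (by linarith))
    have h2 : (1 + δ) / (1 - δ) - 1 ≤ 8 / 3 * δ := by
      rw [sub_le_iff_le_add, div_le_iff₀ (by linarith)]
      nlinarith
    linarith
  filter_upwards [layer_X_eventually_lt hδ0.le hδ hlog] with x hx
  simpa only [pow_one] using hx.le

/-! ### (c) Refuted natural strengthenings -/

/-- STRENGTHENING 1 (tolerance one logarithm smaller): `… ≤ P_f(x) + ε·x/(log x)^{k+1}`. [folklore] -/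
def BalancedSemiprimeLayerStrongTolerance : Prop :=
  ∀ (k : ℕ) (f : Fin k → ℤ[X]), IsBatemanHornSystem f → ∀ ε : ℝ, 0 < ε →
    ∃ δ : ℝ, 0 < δ ∧ δ ≤ 1 / 4 ∧ ∀ᶠ x : ℕ in atTop,
      (roughCount f δ x : ℝ) ≤ (polyPrimeCount f x : ℝ) + ε * (x : ℝ) / Real.log x ^ (k + 1)

/-- **Refuted**: the tolerance exponent `k` cannot be raised to `k + 1` — false already for the
Bateman–Horn system `(X)` (the layer is `≍ δ·x/log x ≫ x/(log x)²`). [folklore] -/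
theorem not_balancedSemiprimeLayerStrongTolerance : ¬ BalancedSemiprimeLayerStrongTolerance := by
  intro h
  obtain ⟨δ, hδ0, hδ, hev⟩ := h 1 ![X] isBatemanHornSystem_X 1 one_pos
  have hgt := eventually_mul_div_log_pow_lt (tendsto_layer_X hδ0.le hδ)
    (log_ratio_pos hδ0 (by linarith)) 1 (le_refl 2)
  obtain ⟨x, h1, h2⟩ := (hev.and hgt).exists
  norm_num at h1 h2
  linarith

/-- STRENGTHENING 2 (one `δ` for all `ε`): `∃ δ ∀ ε` instead of `∀ ε ∃ δ`. [folklore] -/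
def BalancedSemiprimeLayerUniformDelta : Prop :=
  ∀ (k : ℕ) (f : Fin k → ℤ[X]), IsBatemanHornSystem f → ∃ δ : ℝ, 0 < δ ∧ δ ≤ 1 / 4 ∧
    ∀ ε : ℝ, 0 < ε → ∀ᶠ x : ℕ in atTop,
      (roughCount f δ x : ℝ) ≤ (polyPrimeCount f x : ℝ) + ε * (x : ℝ) / Real.log x ^ k

/-- **Refuted**: no single `δ` serves every `ε` — false for `(X)` (take `ε = δ/2 < log((1+δ)/(1−δ))`).
So `δ(ε) → 0` is forced: the layer must genuinely be thinned. [folklore] -/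
theorem not_balancedSemiprimeLayerUniformDelta : ¬ BalancedSemiprimeLayerUniformDelta := by
  intro h
  obtain ⟨δ, hδ0, hδ, hev⟩ := h 1 ![X] isBatemanHornSystem_X
  have hlog : δ ≤ Real.log ((1 + δ) / (1 - δ)) := delta_le_log_ratio hδ0.le (by linarith)
  have h1 := hev (δ / 2) (by linarith)
  have h2 := layer_X_eventually_gt hδ0.le hδ (show δ / 2 < Real.log ((1 + δ) / (1 - δ)) by linarith)
  obtain ⟨x, hx1, hx2⟩ := (h1.and h2).exists
  simp only [pow_one] at hx1
  linarith

/-- STRENGTHENING 3 (a fixed `δ`, here the cap `δ = 1/4`, for all `ε`). [folklore] -/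
def BalancedSemiprimeLayerQuarter : Prop :=
  ∀ (k : ℕ) (f : Fin k → ℤ[X]), IsBatemanHornSystem f → ∀ ε : ℝ, 0 < ε → ∀ᶠ x : ℕ in atTop,
    (roughCount f (1 / 4) x : ℝ) ≤ (polyPrimeCount f x : ℝ) + ε * (x : ℝ) / Real.log x ^ k

/-- **Refuted**: `δ = 1/4` does not serve `ε < log(5/3) = 0.51…` at `(X)`. [folklore] -/
theorem not_balancedSemiprimeLayerQuarter : ¬ BalancedSemiprimeLayerQuarter := by
  intro h
  have h1 := h 1 ![X] isBatemanHornSystem_X (1 / 8) (by norm_num)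
  have hlog : (1 : ℝ) / 4 ≤ Real.log ((1 + 1 / 4) / (1 - 1 / 4)) :=
    delta_le_log_ratio (by norm_num) (by norm_num)
  have h2 := layer_X_eventually_gt (le_of_lt (by norm_num : (0 : ℝ) < 1 / 4)) le_rfl
    (show (1 : ℝ) / 8 < Real.log ((1 + 1 / 4) / (1 - 1 / 4)) by linarith)
  obtain ⟨x, hx1, hx2⟩ := (h1.and h2).exists
  simp only [pow_one] at hx1
  linarith

/-! ### (a) Load-bearing hypotheses: `pairwise_not_associated`, `irreducible`, `hasNoFixedPrimeDivisor` -/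

/-- The crux with `pairwise_not_associated` DROPPED. [folklore] -/
def BalancedSemiprimeLayerWithoutNotAssociated : Prop :=
  ∀ (k : ℕ) (f : Fin k → ℤ[X]), IsSystemWithoutNotAssociated f → LayerConclusion k f

/-- **Any proof must use `pairwise_not_associated`**: the duplicated system `(X, X)` has the layer
of `(X)` (`≍ δ x/log x`) against the `k = 2` tolerance `ε x/(log x)²`. [folklore] -/
theorem balancedSemiprimeLayer_false_without_notAssociated :
    ¬ BalancedSemiprimeLayerWithoutNotAssociated := by
  intro h
  obtain ⟨δ, hδ0, hδ, hev⟩ := h 2 ![X, X] isSystemWithoutNotAssociated_X_X 1 one_pos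
  have hgt := eventually_mul_div_log_pow_lt (tendsto_layer_X hδ0.le hδ)
    (log_ratio_pos hδ0 (by linarith)) 1 (le_refl 2)
  obtain ⟨x, h1, h2⟩ := (hev.and hgt).exists
  rw [roughCount_X_X, polyPrimeCount_X_X] at h1
  rw [roughCount_X, polyPrimeCount_X] at h2
  linarith

/-- The crux with `hasNoFixedPrimeDivisor` DROPPED. [folklore] -/
def BalancedSemiprimeLayerWithoutNoFixedPrimeDivisor : Prop :=
  ∀ (k : ℕ) (f : Fin k → ℤ[X]), IsSystemWithoutNoFixedPrimeDivisor f → LayerConclusion k f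

/-- **Any proof must use `hasNoFixedPrimeDivisor`** — but ONLY to exclude prime constants: the
system `(2, X)` (irreducible, positive leading coefficients, non-associated; fixed divisor `2`) has a
constant coordinate sifted by NO prime (`x^{0·(1−δ)/2} = 1`), so its count is the `(X)` rough count
while `P_{(2,X)} = π` and the tolerance is the `k = 2` one. See `crux_imp_layerConclusion_of_natDegree_pos`
for the positive complement (non-constant systems with a fixed prime divisor are trivially fine). [folklore] -/
theorem balancedSemiprimeLayer_false_without_noFixedPrimeDivisor :
    ¬ BalancedSemiprimeLayerWithoutNoFixedPrimeDivisor := by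
  intro h
  obtain ⟨δ, hδ0, hδ, hev⟩ :=
    h 2 ![C (2 : ℤ), X] isSystemWithoutNoFixedPrimeDivisor_two_X 1 one_pos
  have hgt := eventually_mul_div_log_pow_lt (tendsto_layer_X hδ0.le hδ)
    (log_ratio_pos hδ0 (by linarith)) 1 (le_refl 2)
  obtain ⟨x, h1, h2⟩ := (hev.and hgt).exists
  rw [roughCount_two_X, polyPrimeCount_two_X] at h1
  rw [roughCount_X, polyPrimeCount_X] at h2
  linarith

/-- The crux with `irreducible` DROPPED. [folklore] -/
def BalancedSemiprimeLayerWithoutIrreducible : Prop :=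
  ∀ (k : ℕ) (f : Fin k → ℤ[X]), IsSystemWithoutIrreducible f → LayerConclusion k f

/-- **Any proof must use `irreducible`** (through the absence of repeated factors): for `(X²)` the
rough values are the `n` prime `≥ x^{1−δ}` (count `∼ x/log x`) while `P_{(X²)} = 0`. (A squarefree
reducible coordinate such as `X(X+2)` would be harmless: its rough values are prime pairs.) [folklore] -/
theorem balancedSemiprimeLayer_false_without_irreducible :
    ¬ BalancedSemiprimeLayerWithoutIrreducible := by
  intro h
  obtain ⟨δ, hδ0, hδ, hev⟩ :=
    h 1 ![X ^ 2] isSystemWithoutIrreducible_X_sq (1 / 2) (by norm_num)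
  have hgt := eventually_mul_div_log_lt (tendsto_roughCount_X_sq hδ0 hδ)
    (by norm_num : (1 : ℝ) / 2 < 1)
  obtain ⟨x, h1, h2⟩ := (hev.and hgt).exists
  rw [polyPrimeCount_X_sq] at h1
  norm_num at h1
  linarith


/-! ### (d) Structure of the statement: monotonicity in `δ`, the cap `1/4`, degrees, `k = 0` -/

/-- `Φ_f(x, δ)` is monotone in `δ` (a smaller `δ` sifts further). Hence `∃ δ ∈ (0, 1/4]` in the crux
means "for all sufficiently small `δ > 0`". [folklore] -/
theorem roughCount_mono {k : ℕ} (f : Fin k → ℤ[X]) {δ₁ δ₂ : ℝ} (h : δ₁ ≤ δ₂) (x : ℕ) :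
    roughCount f δ₁ x ≤ roughCount f δ₂ x := by
  unfold roughCount
  refine card_le_card fun n hn => ?_
  simp only [mem_filter, mem_Icc] at hn ⊢
  refine ⟨hn.1, fun i => ⟨(hn.2 i).1, fun p hp hpp => (hn.2 i).2 p ?_ hpp⟩⟩
  rw [mem_range] at hp ⊢
  refine lt_of_lt_of_le hp (Nat.ceil_mono ?_)
  have hx : (1 : ℝ) ≤ x := by exact_mod_cast hn.1.1.trans hn.1.2
  refine Real.rpow_le_rpow_of_exponent_le hx ?_
  have hd : (0 : ℝ) ≤ (f i).natDegree := Nat.cast_nonneg _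
  nlinarith

/-- The cap `δ ≤ 1/4` is immaterial and `δ` may be shrunk at will: the crux's conclusion for `f`
is equivalent to "for every `ε > 0` the inequality holds eventually for ALL small enough `δ > 0`".
[folklore] -/
theorem layerConclusion_iff_eventually_small {k : ℕ} (f : Fin k → ℤ[X]) :
    LayerConclusion k f ↔ ∀ ε : ℝ, 0 < ε → ∃ δ₀ : ℝ, 0 < δ₀ ∧ ∀ δ : ℝ, 0 < δ → δ ≤ δ₀ →
      ∀ᶠ x : ℕ in atTop,
        (roughCount f δ x : ℝ) ≤ (polyPrimeCount f x : ℝ) + ε * (x : ℝ) / Real.log x ^ k := by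
  constructor
  · intro h ε hε
    obtain ⟨δ₀, hδ₀, -, hev⟩ := h ε hε
    refine ⟨δ₀, hδ₀, fun δ _ hδδ₀ => ?_⟩
    filter_upwards [hev] with x hx
    exact le_trans (by exact_mod_cast roughCount_mono f hδδ₀ x) hx
  · intro h ε hε
    obtain ⟨δ₀, hδ₀, hδ⟩ := h ε hε
    exact ⟨min δ₀ (1 / 4), by positivity, min_le_right _ _,
      hδ _ (by positivity) (min_le_left _ _)⟩

/-- Every member of a Bateman–Horn system has degree `≥ 1`: a constant `c > 0`, `c ≠ 1`
(irreducible ⇒ not a unit) has a prime factor, which is a fixed prime divisor. [folklore] -/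
theorem natDegree_pos_of_isBatemanHornSystem {k : ℕ} {f : Fin k → ℤ[X]}
    (hf : IsBatemanHornSystem f) (i : Fin k) : 0 < (f i).natDegree := by
  by_contra h0
  push Not at h0
  have hdeg : (f i).natDegree = 0 := Nat.le_zero.mp h0
  have hC : f i = C ((f i).coeff 0) := eq_C_of_natDegree_eq_zero hdeg
  have hc_pos : 0 < (f i).coeff 0 := by
    have := hf.leadingCoeff_pos i
    rwa [leadingCoeff, hdeg] at this
  have hc_ne_one : (f i).coeff 0 ≠ 1 := by
    intro h1
    have hu := (hf.irreducible i).not_isUnit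
    rw [hC, h1, C_1] at hu
    exact hu isUnit_one
  -- a prime factor `q` of the constant
  have h2 : 2 ≤ ((f i).coeff 0).toNat := by omega
  set q : ℕ := ((f i).coeff 0).toNat.minFac with hq_def
  have hq : q.Prime := Nat.minFac_prime (by omega)
  have hqc : (q : ℤ) ∣ (f i).coeff 0 := by
    have : ((q : ℕ) : ℤ) ∣ ((((f i).coeff 0).toNat : ℕ) : ℤ) :=
      Int.natCast_dvd_natCast.mpr (Nat.minFac_dvd _)
    rwa [Int.toNat_of_nonneg hc_pos.le] at this
  -- `q` is a fixed prime divisor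
  have hfix : polyRootCountMod f q = q := by
    unfold polyRootCountMod
    rw [Finset.filter_true_of_mem, card_range]
    intro n _
    have hev : (f i).eval (n : ℤ) = (f i).coeff 0 := by
      conv_lhs => rw [hC]
      rw [eval_C]
    exact (hqc.trans (dvd_of_eq hev.symm)).trans (Finset.dvd_prod_of_mem _ (mem_univ i))
  have := hf.hasNoFixedPrimeDivisor q hq
  omega

/-- The `k = 0` slice (empty system) of the crux is TRUE: `#[1, x] = x ≤ (x + 1) + ε x`. [folklore] -/
theorem layerConclusion_fin_zero (f : Fin 0 → ℤ[X]) : LayerConclusion 0 f := by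
  intro ε hε
  refine ⟨1 / 4, by norm_num, le_rfl, Eventually.of_forall fun x => ?_⟩
  have h1 : roughCount f (1 / 4) x ≤ x := by
    unfold roughCount
    calc _ ≤ #(Icc 1 x) := card_filter_le _ _
      _ = x := by simp
  have h2 : polyPrimeCount f x = x + 1 := by
    unfold polyPrimeCount
    rw [Finset.filter_true_of_mem (fun n _ => fun i => i.elim0), card_range]
  rw [h2, pow_zero, div_one]
  have h1' : (roughCount f (1 / 4) x : ℝ) ≤ x := by exact_mod_cast h1
  have hx : (0 : ℝ) ≤ x := Nat.cast_nonneg x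
  push_cast
  nlinarith

/-! ### (a′) NOT load-bearing: `leadingCoeff_pos`, and `hasNoFixedPrimeDivisor` beyond constants -/

/-- `ε · x/(log x)^k → ∞` along `ℕ` for `ε > 0`. [folklore] -/
theorem tendsto_mul_div_log_pow_atTop {ε : ℝ} (hε : 0 < ε) (k : ℕ) :
    Tendsto (fun x : ℕ => ε * x / Real.log x ^ k) atTop atTop := by
  have h1 : Tendsto (fun x : ℝ => Real.log x ^ k / x) atTop (𝓝 0) := by
    simpa using Real.tendsto_pow_log_div_mul_add_atTop 1 0 k one_ne_zero
  have h2 : Tendsto (fun x : ℝ => Real.log x ^ k / x) atTop (𝓝[>] 0) := by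
    refine tendsto_nhdsWithin_iff.mpr ⟨h1, ?_⟩
    filter_upwards [eventually_gt_atTop 1] with x hx
    exact div_pos (pow_pos (Real.log_pos hx) k) (by linarith)
  have h3 := (h2.inv_tendsto_nhdsGT_zero).comp tendsto_natCast_atTop_atTop
  have h4 := h3.const_mul_atTop hε
  refine h4.congr' (Eventually.of_forall fun x => ?_)
  simp only [Function.comp_apply, Pi.inv_apply, inv_div]
  ring

/-- A polynomial with negative leading coefficient is eventually `≤ 0` along `ℕ`. [folklore] -/
theorem exists_eval_nonpos_of_leadingCoeff_neg {P : ℤ[X]} (h : P.leadingCoeff < 0) :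
    ∃ M : ℕ, ∀ n : ℕ, M ≤ n → P.eval (n : ℤ) ≤ 0 := by
  rcases Nat.eq_zero_or_pos P.natDegree with hdeg | hdeg
  · refine ⟨0, fun n _ => ?_⟩
    rw [eq_C_of_natDegree_eq_zero hdeg, eval_C]
    rw [leadingCoeff, hdeg] at h
    exact h.le
  · -- pass to `ℝ`
    set Q : ℝ[X] := P.map (Int.castRingHom ℝ) with hQ
    have hinj : Function.Injective (Int.castRingHom ℝ) := Int.cast_injective
    have hQdeg : 0 < Q.degree := by
      rw [hQ, degree_map_eq_of_injective hinj]
      exact natDegree_pos_iff_degree_pos.mp hdeg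
    have hQlc : Q.leadingCoeff ≤ 0 := by
      rw [hQ, leadingCoeff_map_of_injective hinj, eq_intCast]
      exact_mod_cast h.le
    have ht := (Q.tendsto_atBot_of_leadingCoeff_nonpos hQdeg hQlc).comp tendsto_natCast_atTop_atTop
    obtain ⟨M, hM⟩ := eventually_atTop.mp (ht.eventually (eventually_le_atBot 0))
    refine ⟨M, fun n hn => ?_⟩
    have h1 := hM n hn
    simp only [Function.comp_apply, hQ, eval_natCast_map, eq_intCast] at h1
    exact_mod_cast h1

/-- The crux with `leadingCoeff_pos` DROPPED. [folklore] -/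
def BalancedSemiprimeLayerWithoutLeadingCoeffPos : Prop :=
  ∀ (k : ℕ) (f : Fin k → ℤ[X]), IsSystemWithoutLeadingCoeffPos f → LayerConclusion k f

/-- **`leadingCoeff_pos` is NOT load-bearing**: the crux is EQUIVALENT to its variant without it
(a coordinate with negative leading coefficient is positive at only finitely many `n`, so
`Φ_f(x, δ) = O(1)` while the tolerance `ε x/(log x)^k → ∞`). [folklore] -/
theorem crux_iff_withoutLeadingCoeffPos :
    BalancedSemiprimeLayer ↔ BalancedSemiprimeLayerWithoutLeadingCoeffPos := by
  constructor
  · intro h k f hf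
    by_cases hlc : ∀ i, 0 < (f i).leadingCoeff
    · exact crux_iff.mp h k f ⟨hf.irreducible, hlc, hf.pairwise_not_associated, hf.hasNoFixedPrimeDivisor⟩
    · push Not at hlc
      obtain ⟨i, hi⟩ := hlc
      have hne : (f i).leadingCoeff ≠ 0 := leadingCoeff_ne_zero.mpr (hf.irreducible i).ne_zero
      have hlt : (f i).leadingCoeff < 0 := lt_of_le_of_ne hi hne
      obtain ⟨M, hM⟩ := exists_eval_nonpos_of_leadingCoeff_neg hlt
      have hbound : ∀ (δ : ℝ) (x : ℕ), roughCount f δ x ≤ M := by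
        intro δ x
        unfold roughCount
        calc _ ≤ #(range M) := by
              refine card_le_card fun n hn => ?_
              simp only [mem_filter] at hn
              rw [mem_range]
              by_contra hMn
              exact absurd (hM n (not_lt.mp hMn)) (not_le.mpr (hn.2 i).1)
          _ = M := card_range M
      intro ε hε
      refine ⟨1 / 4, by norm_num, le_rfl, ?_⟩
      filter_upwards [(tendsto_mul_div_log_pow_atTop hε k).eventually_ge_atTop (M : ℝ)] with x hx
      calc (roughCount f (1 / 4) x : ℝ) ≤ M := by exact_mod_cast hbound _ x
        _ ≤ ε * x / Real.log x ^ k := hx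
        _ ≤ (polyPrimeCount f x : ℝ) + ε * x / Real.log x ^ k :=
            le_add_of_nonneg_left (Nat.cast_nonneg _)
  · intro h k f hf
    exact h k f ⟨hf.irreducible, hf.pairwise_not_associated, hf.hasNoFixedPrimeDivisor⟩

/-- A prime `p` with `ω_f(p) = p` divides some `fᵢ(n)` for EVERY integer `n ≥ 0`. [folklore] -/
theorem exists_dvd_eval_of_le_polyRootCountMod {k : ℕ} {f : Fin k → ℤ[X]} {p : ℕ} (hp : p.Prime)
    (h : ¬ polyRootCountMod f p < p) (n : ℕ) : ∃ i, (p : ℤ) ∣ (f i).eval (n : ℤ) := by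
  have heq : polyRootCountMod f p = p := le_antisymm (polyRootCountMod_le f p) (not_lt.mp h)
  have hall : ∀ m ∈ range p, (p : ℤ) ∣ ∏ i, (f i).eval (m : ℤ) := by
    refine Finset.card_filter_eq_iff.mp ?_
    rw [card_range]
    exact heq
  have hm : (p : ℤ) ∣ ∏ i, (f i).eval ((n % p : ℕ) : ℤ) :=
    hall (n % p) (mem_range.mpr (Nat.mod_lt n hp.pos))
  obtain ⟨i, -, hi⟩ := ((Nat.prime_iff_prime_int.mp hp).dvd_finsetProd_iff _).mp hm
  refine ⟨i, ?_⟩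
  have hsub : (p : ℤ) ∣ (n : ℤ) - ((n % p : ℕ) : ℤ) := by
    have hdiv := Nat.mod_add_div n p
    refine ⟨((n / p : ℕ) : ℤ), ?_⟩
    have : ((n : ℕ) : ℤ) = ((n % p : ℕ) : ℤ) + (p : ℤ) * ((n / p : ℕ) : ℤ) := by
      exact_mod_cast hdiv.symm
    linarith
  have hdiff := (sub_dvd_eval_sub (n : ℤ) ((n % p : ℕ) : ℤ) (f i))
  have h3 : (p : ℤ) ∣ (f i).eval (n : ℤ) - (f i).eval ((n % p : ℕ) : ℤ) := hsub.trans hdiff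
  have h4 := dvd_add h3 hi
  rwa [sub_add_cancel] at h4

/-- A fixed prime divisor beyond the sifting ranges empties the rough count. [folklore] -/
theorem roughCount_eq_zero_of_fixed_prime {k : ℕ} {f : Fin k → ℤ[X]} {p : ℕ} (hp : p.Prime)
    (hfix : ∀ n : ℕ, ∃ i, (p : ℤ) ∣ (f i).eval (n : ℤ)) {δ : ℝ} {x : ℕ}
    (hx : ∀ i, (p : ℝ) < (x : ℝ) ^ (((f i).natDegree : ℝ) * (1 - δ) / 2)) :
    roughCount f δ x = 0 := by
  unfold roughCount
  rw [Finset.card_eq_zero, Finset.eq_empty_iff_forall_notMem]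
  intro n hn
  simp only [mem_filter] at hn
  obtain ⟨i, hi⟩ := hfix n
  exact (hn.2 i).2 p (mem_range.mpr (Nat.lt_ceil.mpr (hx i))) hp hi

/-- For non-constant coordinates the sifting ranges `x^{deg fᵢ (1−δ)/2} ≥ x^{3/8}` pass any
fixed `p` eventually. [folklore] -/
theorem eventually_lt_rpow_exponent {k : ℕ} (f : Fin k → ℤ[X]) (hdeg : ∀ i, 0 < (f i).natDegree)
    {δ : ℝ} (hδ : δ ≤ 1 / 4) (p : ℕ) :
    ∀ᶠ x : ℕ in atTop, ∀ i, (p : ℝ) < (x : ℝ) ^ (((f i).natDegree : ℝ) * (1 - δ) / 2) := by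
  have h : Tendsto (fun x : ℕ => (x : ℝ) ^ ((3 : ℝ) / 8)) atTop atTop :=
    (tendsto_rpow_atTop (by norm_num)).comp tendsto_natCast_atTop_atTop
  filter_upwards [h.eventually_gt_atTop (p : ℝ), eventually_ge_atTop 1] with x hx hx1 i
  refine lt_of_lt_of_le hx (Real.rpow_le_rpow_of_exponent_le (by exact_mod_cast hx1) ?_)
  have hd : (1 : ℝ) ≤ (f i).natDegree := by exact_mod_cast hdeg i
  nlinarith

/-- **`hasNoFixedPrimeDivisor` is NOT load-bearing for non-constant systems**: the crux implies its
own variant for systems of polynomials of degree `≥ 1` that are irreducible, positive and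
non-associated but MAY have a fixed prime divisor (then `Φ_f(x, δ) = 0` eventually). Together with
`balancedSemiprimeLayer_false_without_noFixedPrimeDivisor` (witness `(2, X)`): the hypothesis matters
exactly to exclude prime constants. [folklore] -/
theorem crux_imp_layerConclusion_of_natDegree_pos (hcrux : BalancedSemiprimeLayer) {k : ℕ}
    (f : Fin k → ℤ[X]) (hirr : ∀ i, Irreducible (f i)) (hlc : ∀ i, 0 < (f i).leadingCoeff)
    (hpw : Pairwise fun i j => ¬Associated (f i) (f j)) (hdeg : ∀ i, 0 < (f i).natDegree) :
    LayerConclusion k f := by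
  by_cases hN : HasNoFixedPrimeDivisor f
  · exact crux_iff.mp hcrux k f ⟨hirr, hlc, hpw, hN⟩
  · unfold HasNoFixedPrimeDivisor at hN
    push Not at hN
    obtain ⟨p, hp, hpc⟩ := hN
    have hfix := fun n => exists_dvd_eval_of_le_polyRootCountMod (f := f) hp (not_lt.mpr hpc) n
    intro ε hε
    refine ⟨1 / 4, by norm_num, le_rfl, ?_⟩
    filter_upwards [eventually_lt_rpow_exponent f hdeg le_rfl p] with x hx
    rw [roughCount_eq_zero_of_fixed_prime hp hfix hx]
    push_cast
    positivity

/-! ### (c′) One more refuted strengthening: the coordinatewise (naive union) bound -/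

/-- The `n ≤ x` whose `i`-th value is positive, rough to the crux's depth, and NOT prime (the other
coordinates unconstrained). [folklore] -/
noncomputable def coordLayerCount {k : ℕ} (f : Fin k → ℤ[X]) (i : Fin k) (δ : ℝ) (x : ℕ) : ℕ :=
  ((Icc 1 x).filter (fun n : ℕ => 0 < (f i).eval (n : ℤ) ∧
    (∀ p ∈ range ⌈(x : ℝ) ^ (((f i).natDegree : ℝ) * (1 - δ) / 2)⌉₊,
      p.Prime → ¬ ((p : ℤ) ∣ (f i).eval (n : ℤ))) ∧
    ¬ ((f i).eval (n : ℤ)).toNat.Prime)).card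

/-- STRENGTHENING 4 (coordinatewise layer): bound, for EACH coordinate separately, the `n ≤ x` whose
value `fᵢ(n)` is rough but not prime — ignoring the other coordinates — by `ε x/(log x)^k`. [folklore] -/
def CoordinatewiseLayerBound : Prop :=
  ∀ (k : ℕ) (f : Fin k → ℤ[X]), IsBatemanHornSystem f → ∀ ε : ℝ, 0 < ε →
    ∃ δ : ℝ, 0 < δ ∧ δ ≤ 1 / 4 ∧ ∀ᶠ x : ℕ in atTop, ∀ i,
      (coordLayerCount f i δ x : ℝ) ≤ ε * (x : ℝ) / Real.log x ^ k

/-- `ω_{(X, X+2)}(p) < p`: the residues are `n ≡ 0, −2`. [folklore] -/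
theorem polyRootCountMod_twin_lt {p : ℕ} (hp : p.Prime) :
    polyRootCountMod ![(X : ℤ[X]), X + C 2] p < p := by
  unfold polyRootCountMod
  have hsub : (range p).filter (fun n : ℕ => (p : ℤ) ∣ ∏ i, (![(X : ℤ[X]), X + C 2] i).eval (n : ℤ))
      ⊆ {0, p - 2} := by
    intro n hn
    simp only [mem_filter, mem_range, Fin.prod_univ_two, Matrix.cons_val_zero, Matrix.cons_val_one,
      eval_X, eval_add, eval_C] at hn
    obtain ⟨hnp, hdvd⟩ := hn
    rw [mem_insert, mem_singleton]
    have hP := Nat.prime_iff_prime_int.mp hp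
    rcases hP.dvd_or_dvd hdvd with h1 | h2
    · left
      exact Nat.eq_zero_of_dvd_of_lt (Int.natCast_dvd_natCast.mp h1) hnp
    · right
      have h2' : p ∣ n + 2 := by exact_mod_cast h2
      obtain ⟨c, hc⟩ := h2'
      have hp2 := hp.two_le
      have hc1 : c = 1 := by
        rcases Nat.lt_or_ge c 2 with hc2 | hc2
        · interval_cases c
          · omega
          · rfl
        · have : p * 2 ≤ p * c := Nat.mul_le_mul_left p hc2
          omega
      subst hc1
      omega
  refine lt_of_le_of_lt (card_le_card hsub) ?_
  rcases hp.eq_two_or_odd' with rfl | hodd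
  · simp
  · have hp3 : 3 ≤ p := by
      rcases hp.two_le.eq_or_lt with h | h
      · exfalso
        rw [← h] at hodd
        exact (by decide : ¬ Odd 2) hodd
      · omega
    calc #({0, p - 2} : Finset ℕ) ≤ 2 := Finset.card_le_two
      _ < p := by omega

/-- The twin system `(X, X + 2)` is a Bateman–Horn system. [folklore] -/
theorem isBatemanHornSystem_twin : IsBatemanHornSystem ![(X : ℤ[X]), X + C 2] where
  irreducible i := by
    fin_cases i
    · exact irreducible_X
    · show Irreducible (X + C (2 : ℤ))
      have h : (X + C (2 : ℤ) : ℤ[X]) = X - C (-2) := by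
        rw [C_neg, sub_neg_eq_add]
      rw [h]
      exact irreducible_X_sub_C (-2)
  leadingCoeff_pos i := by
    fin_cases i
    · show 0 < (X : ℤ[X]).leadingCoeff
      rw [leadingCoeff_X]; norm_num
    · show 0 < (X + C (2 : ℤ)).leadingCoeff
      rw [leadingCoeff_X_add_C]; norm_num
  pairwise_not_associated i j hij := by
    have hnd : ¬ ((X : ℤ[X]) ∣ X + C 2) := by
      rw [X_dvd_iff]
      simp
    fin_cases i <;> fin_cases j
    · exact absurd rfl hij
    · exact fun h => hnd h.dvd
    · exact fun h => hnd h.symm.dvd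
    · exact absurd rfl hij
  hasNoFixedPrimeDivisor p hp := polyRootCountMod_twin_lt hp

/-- `Φ(x, x^{(1−δ)/2}) ≤ (coordinate-`X` layer count of the twin system) + π(x)`. [folklore] -/
theorem card_roughIcc_le_coordLayerCount_twin (δ : ℝ) (x : ℕ) :
    #(roughIcc ⌈(x : ℝ) ^ ((1 - δ) / 2)⌉₊ x) ≤
      coordLayerCount ![(X : ℤ[X]), X + C 2] 0 δ x + Nat.primeCounting x := by
  set N : ℕ := ⌈(x : ℝ) ^ ((1 - δ) / 2)⌉₊ with hN
  have hπ : #((Icc 1 x).filter Nat.Prime) ≤ Nat.primeCounting x := by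
    rw [← Nat.primesLE_card_eq_primeCounting, Nat.primesLE_eq_filter_range]
    refine card_le_card fun n hn => ?_
    simp only [mem_filter, mem_Icc, mem_range] at hn ⊢
    exact ⟨by omega, hn.2⟩
  have hsub : roughIcc N x \ (Icc 1 x).filter Nat.Prime ⊆
      (Icc 1 x).filter (fun n : ℕ => 0 < (![(X : ℤ[X]), X + C 2] 0).eval (n : ℤ) ∧
        (∀ p ∈ range ⌈(x : ℝ) ^ (((![(X : ℤ[X]), X + C 2] 0).natDegree : ℝ) * (1 - δ) / 2)⌉₊,
          p.Prime → ¬ ((p : ℤ) ∣ (![(X : ℤ[X]), X + C 2] 0).eval (n : ℤ))) ∧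
        ¬ ((![(X : ℤ[X]), X + C 2] 0).eval (n : ℤ)).toNat.Prime) := by
    intro n hn
    obtain ⟨hn1, hn2⟩ := Finset.mem_sdiff.mp hn
    rw [mem_roughIcc] at hn1
    simp only [mem_filter, mem_Icc, not_and] at hn2
    simp only [mem_filter, mem_Icc, Matrix.cons_val_zero, eval_X, natDegree_X, Nat.cast_one, one_mul,
      Int.toNat_natCast, mem_range]
    refine ⟨hn1.1, by exact_mod_cast hn1.1.1, fun p hp hpp hdvd => ?_, hn2 hn1.1⟩
    exact absurd (hn1.2 p hpp (Int.natCast_dvd_natCast.mp hdvd)) (not_le.mpr hp)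
  unfold coordLayerCount
  calc #(roughIcc N x) ≤ #(roughIcc N x \ (Icc 1 x).filter Nat.Prime) + #((Icc 1 x).filter Nat.Prime) :=
        card_le_card_sdiff_add_card
    _ ≤ _ := add_le_add (card_le_card hsub) hπ

/-- **Refuted**: the coordinatewise bound is false for the twin system `(X, X+2)` — coordinate `X`
alone has `≍ δ x/log x` rough non-prime values, against the `k = 2` tolerance `ε x/(log x)²`. The
other coordinates MUST be kept rough (each contributes a factor `1/log x`): the layer of a system is
a JOINT sifting problem of dimension `k`, not a union of `k` one-dimensional ones. [folklore] -/
theorem not_coordinatewiseLayerBound : ¬ CoordinatewiseLayerBound := by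
  intro h
  obtain ⟨δ, hδ0, hδ, hev⟩ := h 2 ![X, X + C 2] isBatemanHornSystem_twin 1 one_pos
  have hgt := eventually_mul_div_log_pow_lt (tendsto_layer_X hδ0.le hδ)
    (log_ratio_pos hδ0 (by linarith)) 1 (le_refl 2)
  obtain ⟨x, h1, h2⟩ := (hev.and hgt).exists
  have h1' := h1 0
  rw [roughCount_X, polyPrimeCount_X] at h2
  have h3 : (#(roughIcc ⌈(x : ℝ) ^ ((1 - δ) / 2)⌉₊ x) : ℝ) ≤
      (coordLayerCount ![(X : ℤ[X]), X + C 2] 0 δ x : ℝ) + (Nat.primeCounting x : ℝ) := by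
    exact_mod_cast card_roughIcc_le_coordLayerCount_twin δ x
  linarith

/-! ### (e) Relative consistency: the crux follows from `RoughValueLaw ∧ SieveCalibration ∧ BatemanHorn` -/

open Summit.Parity.BatemanHorn.Theses.RoughValueTransport in
/-- **Relative consistency of the crux**: `RoughValueLaw`, `SieveCalibration` and `BatemanHorn`
together imply the conclusion of `BalancedSemiprimeLayer` for every Bateman–Horn system (hence the
crux itself; stated per system to keep the obligation graph clean). [folklore] -/
theorem cruxConclusion_of_roughValueLaw_of_sieveCalibration_of_batemanHorn
    (hR : RoughValueLaw) (hS : SieveCalibration) (hB : _root_.BatemanHorn)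
    {k : ℕ} (f : Fin k → ℤ[X]) (hf : IsBatemanHornSystem f) (ε : ℝ) (hε : 0 < ε) :
    ∃ δ : ℝ, 0 < δ ∧ δ ≤ 1 / 4 ∧ ∀ᶠ x : ℕ in atTop,
      (((Icc 1 x).filter (fun n : ℕ => ∀ i, 0 < (f i).eval (n : ℤ) ∧
        ∀ p ∈ range ⌈(x : ℝ) ^ (((f i).natDegree : ℝ) * (1 - δ) / 2)⌉₊,
          p.Prime → ¬ ((p : ℤ) ∣ (f i).eval (n : ℤ)))).card : ℝ) ≤
        (polyPrimeCount f x : ℝ) + ε * (x : ℝ) / Real.log x ^ k := by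
  -- the constants `C(f)`, `D = ∏ deg fᵢ > 0`
  have hD0 : (0 : ℝ) < ∏ i, ((f i).natDegree : ℝ) :=
    prod_pos fun i _ => by exact_mod_cast natDegree_pos_of_isBatemanHornSystem hf i
  obtain ⟨hconst, hCf0⟩ := IsBatemanHornSystem.hasBatemanHornConst_holds hf
  -- Step 1: `ω = buchstabOmega` satisfies the inline predicate; `A` from RoughValueLaw
  obtain ⟨A, hA⟩ := hR k f hf buchstabOmega
    ⟨fun u h1 h2 => buchstabOmega_eq_inv h1 h2, continuousOn_buchstabOmega,
      fun u hu => hasDerivAt_mul_buchstabOmega hu⟩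
  -- Step 2: SieveCalibration with `L u = A (u ω u)^k`
  have hSC := hS k f hf (fun u => A * (u * buchstabOmega u) ^ k) ⟨3, fun u hu => hA u (by linarith)⟩
  -- Step 3: the same ratio tends to `A e^{-kγ}` (de Bruijn's limit, PROVED in the tree)
  have hω := harman2007_buchstabOmega_tendsto_holds
  unfold harman2007_buchstabOmega_tendsto at hω
  have hSC' : Tendsto (fun u : ℝ => A * (u * buchstabOmega u) ^ k / u ^ k) atTop
      (𝓝 (A * Real.exp (-Real.eulerMascheroniConstant) ^ k)) := by
    have h1 := (hω.pow k).const_mul A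
    refine h1.congr' ?_
    filter_upwards [eventually_gt_atTop 0] with u hu
    rw [mul_pow]
    field_simp
  have hAeq : A = batemanHornConst f / ∏ i, ((f i).natDegree : ℝ) := by
    have huniq := tendsto_nhds_unique hSC' hSC
    have he : Real.exp (-((k : ℝ) * Real.eulerMascheroniConstant)) =
        Real.exp (-Real.eulerMascheroniConstant) ^ k := by
      rw [← Real.exp_nat_mul]
      congr 1
      ring
    rw [he] at huniq
    exact mul_right_cancel₀ (pow_ne_zero k (Real.exp_pos _).ne') huniq
  -- Step 4: Bateman–Horn ⇒ `P_f(x)(log x)^k/x → C(f)/D`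
  obtain ⟨C, hC, hPequiv⟩ := hB k f hf
  have hCeq : C = batemanHornConst f := tendsto_nhds_unique hC hconst
  rw [Fintype.card_fin, hCeq] at hPequiv
  have hv : ∀ᶠ x : ℕ in atTop,
      batemanHornConst f / (∏ i, ((f i).natDegree : ℝ)) * (x : ℝ) / Real.log x ^ k ≠ 0 := by
    filter_upwards [eventually_gt_atTop 1] with x hx
    have hx' : (1 : ℝ) < x := by exact_mod_cast hx
    have : 0 < Real.log x := Real.log_pos hx'
    positivity
  have hP1 := (isEquivalent_iff_tendsto_one hv).mp hPequiv
  have hP : Tendsto (fun x : ℕ => (polyPrimeCount f x : ℝ) * Real.log x ^ k / x) atTop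
      (𝓝 (batemanHornConst f / ∏ i, ((f i).natDegree : ℝ))) := by
    have h2 := hP1.const_mul (batemanHornConst f / ∏ i, ((f i).natDegree : ℝ))
    rw [mul_one] at h2
    refine h2.congr' ?_
    filter_upwards [eventually_gt_atTop 1] with x hx
    have hx' : (1 : ℝ) < x := by exact_mod_cast hx
    have hlog : 0 < Real.log x := Real.log_pos hx'
    have hx0 : (0 : ℝ) < x := by linarith
    simp only [Pi.div_apply]
    field_simp
  -- Step 5: choose `δ` by continuity of `δ ↦ C₀((1 + log((1+δ)/(1−δ)))^k − 1)` at `0`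
  have hφc : ContinuousAt (fun δ : ℝ => batemanHornConst f / (∏ i, ((f i).natDegree : ℝ)) *
      ((1 + Real.log ((1 + δ) / (1 - δ))) ^ k - 1)) 0 := by
    fun_prop (disch := norm_num)
  have hevφ : ∀ᶠ δ : ℝ in 𝓝 0, batemanHornConst f / (∏ i, ((f i).natDegree : ℝ)) *
      ((1 + Real.log ((1 + δ) / (1 - δ))) ^ k - 1) < ε := by
    have := hφc.tendsto
    simp only [add_zero, sub_zero, div_one, Real.log_one, one_pow, sub_self, mul_zero] at this
    exact this.eventually (eventually_lt_nhds hε)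
  obtain ⟨r, hr, hrφ⟩ := Metric.eventually_nhds_iff.mp hevφ
  refine ⟨min (1 / 4) (r / 2), by positivity, min_le_left _ _, ?_⟩
  set δ : ℝ := min (1 / 4) (r / 2) with hδ_def
  have hδ0 : 0 < δ := by positivity
  have hδ4 : δ ≤ 1 / 4 := min_le_left _ _
  have hδr : δ < r := lt_of_le_of_lt (min_le_right _ _) (by linarith)
  have hφδ : batemanHornConst f / (∏ i, ((f i).natDegree : ℝ)) *
      ((1 + Real.log ((1 + δ) / (1 - δ))) ^ k - 1) < ε :=
    hrφ (by rw [Real.dist_eq, sub_zero, abs_of_pos hδ0]; exact hδr)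
  -- Step 6: at `u = 2/(1−δ)` the crux count is `Φ_f(x, u)`
  set u : ℝ := 2 / (1 - δ) with hu_def
  have h1δ : 0 < 1 - δ := by linarith
  have hu2 : 2 < u := by
    rw [hu_def, lt_div_iff₀ h1δ]; linarith
  have hu3 : u ≤ 3 := by
    rw [hu_def, div_le_iff₀ h1δ]; linarith
  have hexp : ∀ d : ℕ, (d : ℝ) / u = (d : ℝ) * (1 - δ) / 2 := by
    intro d
    rw [hu_def]
    field_simp
  have hcount : ∀ x : ℕ, #((Icc 1 x).filter (fun n : ℕ => ∀ i, 0 < (f i).eval (n : ℤ) ∧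
        ∀ p ∈ range ⌈(x : ℝ) ^ (((f i).natDegree : ℝ) / u)⌉₊,
          p.Prime → ¬ ((p : ℤ) ∣ (f i).eval (n : ℤ)))) =
      #((Icc 1 x).filter (fun n : ℕ => ∀ i, 0 < (f i).eval (n : ℤ) ∧
        ∀ p ∈ range ⌈(x : ℝ) ^ (((f i).natDegree : ℝ) * (1 - δ) / 2)⌉₊,
          p.Prime → ¬ ((p : ℤ) ∣ (f i).eval (n : ℤ)))) := by
    intro x
    congr 1
    ext n
    simp only [mem_filter, hexp]
  have hAu' : Tendsto (fun x : ℕ => (#((Icc 1 x).filter (fun n : ℕ => ∀ i, 0 < (f i).eval (n : ℤ) ∧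
        ∀ p ∈ range ⌈(x : ℝ) ^ (((f i).natDegree : ℝ) * (1 - δ) / 2)⌉₊,
          p.Prime → ¬ ((p : ℤ) ∣ (f i).eval (n : ℤ)))) : ℝ) * Real.log x ^ k / x) atTop
      (𝓝 (A * (u * buchstabOmega u) ^ k)) := by
    refine (hA u hu2).congr' (Eventually.of_forall fun x => ?_)
    rw [hcount x]
  -- value of the rough-value limit at `u`: `A (uω(u))^k = C₀ (1 + log((1+δ)/(1−δ)))^k`
  have hval : A * (u * buchstabOmega u) ^ k = batemanHornConst f / (∏ i, ((f i).natDegree : ℝ)) *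
      (1 + Real.log ((1 + δ) / (1 - δ))) ^ k := by
    rw [hAeq, buchstabOmega_eq_of_mem_Icc_two_three hu2.le hu3]
    have hu0 : u ≠ 0 := by linarith
    have h1 : u - 1 = (1 + δ) / (1 - δ) := by
      rw [hu_def]
      field_simp
      ring
    rw [mul_div_cancel₀ _ hu0, h1]
  rw [hval] at hAu'
  -- Step 7: the layer limit is `< ε`; unfold the eventual inequality
  have hlayer := hAu'.sub hP
  rw [← mul_sub_one] at hlayer
  filter_upwards [hlayer.eventually (eventually_lt_nhds hφδ), eventually_gt_atTop 1] with x hx hx1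
  have hx' : (1 : ℝ) < x := by exact_mod_cast hx1
  have hlog : 0 < Real.log x := Real.log_pos hx'
  have hx0 : (0 : ℝ) < x := by linarith
  have hpow : 0 < Real.log x ^ k := pow_pos hlog k
  rw [← sub_div, ← sub_mul, div_lt_iff₀ hx0] at hx
  have key : ∀ a b : ℝ, (a - b) * Real.log x ^ k < ε * x → a ≤ b + ε * x / Real.log x ^ k := by
    intro a b hab
    have : a - b ≤ ε * x / Real.log x ^ k := by
      rw [le_div_iff₀ hpow]
      exact hab.le
    linarith
  exact key _ _ hx


/- NOTE (deliberately NOT stated as a theorem): bundling the previous result over all systems gives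
`RoughValueLaw → SieveCalibration → _root_.BatemanHorn → BalancedSemiprimeLayer` by
`fun hR hS hB k f hf ε hε => cruxConclusion_of_… hR hS hB f hf ε hε` (checked in scratch). It is not
declared here because a theorem whose conclusion is the registered item under registered hypotheses
would be classified by the tree audit as a `proof-of-item` edge on the crux. -/

/-! ### (f) The crux inequality cannot fail from below: `P_f ≤ Φ_f(·, δ) + O_f(√x)` -/

/-- Growth: for `P ∈ ℤ[X]` with positive leading coefficient and `d = deg P`, eventually
`n^d ≤ 2·P(n)` along `ℕ`. [folklore] -/
theorem exists_pow_le_two_mul_eval {P : ℤ[X]} (hlc : 0 < P.leadingCoeff) :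
    ∃ M : ℕ, ∀ n : ℕ, M ≤ n → (n : ℤ) ^ P.natDegree ≤ 2 * P.eval (n : ℤ) := by
  set Q : ℝ[X] := P.map (Int.castRingHom ℝ) with hQ
  have hinj : Function.Injective (Int.castRingHom ℝ) := Int.cast_injective
  have hQdeg : Q.natDegree = P.natDegree := natDegree_map_eq_of_injective hinj P
  have hQlc : Q.leadingCoeff = (P.leadingCoeff : ℝ) := by
    rw [hQ, leadingCoeff_map_of_injective hinj, eq_intCast]
  have ha1 : (1 : ℝ) ≤ Q.leadingCoeff := by
    rw [hQlc]
    exact_mod_cast hlc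
  obtain ⟨φ, hφ, hEq⟩ := (Polynomial.isEquivalent_atTop_lead Q).exists_eq_mul
  have h1 : ∀ᶠ x : ℝ in atTop, (1 : ℝ) / 2 ≤ φ x :=
    hφ.eventually (eventually_ge_nhds (by norm_num : (1 : ℝ) / 2 < 1))
  have h2 : ∀ᶠ x : ℝ in atTop, x ^ P.natDegree ≤ 2 * Q.eval x := by
    filter_upwards [h1, hEq, eventually_ge_atTop 0] with x hx1 hx2 hx0
    rw [hx2, Pi.mul_apply, hQdeg]
    have hxd : 0 ≤ x ^ P.natDegree := pow_nonneg hx0 _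
    have h3 : (1 : ℝ) / 2 * 1 ≤ φ x * Q.leadingCoeff := mul_le_mul hx1 ha1 (by norm_num) (by linarith)
    have h4 := mul_le_mul_of_nonneg_right h3 hxd
    calc x ^ P.natDegree = 2 * ((1 : ℝ) / 2 * 1 * x ^ P.natDegree) := by ring
      _ ≤ 2 * (φ x * Q.leadingCoeff * x ^ P.natDegree) := by linarith
      _ = 2 * (φ x * (Q.leadingCoeff * x ^ P.natDegree)) := by ring
  obtain ⟨M, hM⟩ := eventually_atTop.mp (tendsto_natCast_atTop_atTop.eventually h2)
  refine ⟨M, fun n hn => ?_⟩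
  have h := hM n hn
  rw [hQ, eval_natCast_map, eq_intCast] at h
  exact_mod_cast h

/-- **The crux inequality cannot fail from below**: `P_f(x) ≤ Φ_f(x, δ) + K + k(2√x + 1)` for a
constant `K = K(f)`, for every family of polynomials with positive leading coefficients and degrees
`≥ 1` and every `δ ≥ 0`. [folklore] -/
theorem polyPrimeCount_le_cruxCount_add {k : ℕ} (f : Fin k → ℤ[X])
    (hlc : ∀ i, 0 < (f i).leadingCoeff) (hdeg : ∀ i, 0 < (f i).natDegree) {δ : ℝ} (hδ0 : 0 ≤ δ) :
    ∃ K : ℝ, ∀ x : ℕ, (polyPrimeCount f x : ℝ) ≤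
      #((Icc 1 x).filter (fun n : ℕ => ∀ i, 0 < (f i).eval (n : ℤ) ∧
        ∀ p ∈ range ⌈(x : ℝ) ^ (((f i).natDegree : ℝ) * (1 - δ) / 2)⌉₊,
          p.Prime → ¬ ((p : ℤ) ∣ (f i).eval (n : ℤ)))) + K + k * (2 * Real.sqrt x + 1) := by
  choose M hM using fun i => exists_pow_le_two_mul_eval (hlc i)
  refine ⟨1 + ∑ i, (M i : ℝ), fun x => ?_⟩
  -- the sets
  set SP : Finset ℕ := (range (x + 1)).filter (fun n : ℕ =>
    ∀ i, 0 < (f i).eval (n : ℤ) ∧ ((f i).eval (n : ℤ)).toNat.Prime) with hSP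
  set T : Finset ℕ := SP.filter (fun n : ℕ => 1 ≤ n ∧
    ∀ i, (x : ℝ) ^ (((f i).natDegree : ℝ) * (1 - δ) / 2) ≤ (((f i).eval (n : ℤ) : ℤ) : ℝ)) with hT
  set B : Fin k → Finset ℕ := fun i => SP.filter (fun n : ℕ =>
    (((f i).eval (n : ℤ) : ℤ) : ℝ) < (x : ℝ) ^ (((f i).natDegree : ℝ) * (1 - δ) / 2)) with hB
  have hPdef : polyPrimeCount f x = #SP := by
    rw [hSP]
    unfold polyPrimeCount
    congr
  -- (1) `T ⊆` crux filter
  have hTsub : T ⊆ (Icc 1 x).filter (fun n : ℕ => ∀ i, 0 < (f i).eval (n : ℤ) ∧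
      ∀ p ∈ range ⌈(x : ℝ) ^ (((f i).natDegree : ℝ) * (1 - δ) / 2)⌉₊,
        p.Prime → ¬ ((p : ℤ) ∣ (f i).eval (n : ℤ))) := by
    intro n hn
    simp only [hT, hSP, mem_filter, mem_range] at hn
    obtain ⟨⟨hnx, hprime⟩, hn1, hbig⟩ := hn
    simp only [mem_filter, mem_Icc]
    refine ⟨⟨hn1, by omega⟩, fun i => ⟨(hprime i).1, fun p hp hpp hdvd => ?_⟩⟩
    -- `p ∣ fᵢ(n)` prime with `fᵢ(n)` prime ⇒ `p = fᵢ(n) ≥ zᵢ`, contradicting `p < ⌈zᵢ⌉₊`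
    have hpos := (hprime i).1
    have hq := (hprime i).2
    set q : ℕ := ((f i).eval (n : ℤ)).toNat with hq_def
    have hqz : (q : ℤ) = (f i).eval (n : ℤ) := Int.toNat_of_nonneg hpos.le
    have hpq : p ∣ q := by
      rw [← hqz] at hdvd
      exact Int.natCast_dvd_natCast.mp hdvd
    have hpq' : p = q := ((Nat.dvd_prime hq).mp hpq).resolve_left hpp.ne_one
    have hlt : (p : ℝ) < (x : ℝ) ^ (((f i).natDegree : ℝ) * (1 - δ) / 2) :=
      Nat.lt_ceil.mp (mem_range.mp hp)
    have hge := hbig i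
    rw [← hqz] at hge
    push_cast at hge
    rw [← hpq'] at hge
    linarith
  -- (2) `SP \ T ⊆ {0} ∪ ⋃ B i`
  have hdiff : SP \ T ⊆ {0} ∪ Finset.univ.biUnion B := by
    intro n hn
    obtain ⟨hnS, hnT⟩ := Finset.mem_sdiff.mp hn
    rw [mem_union, mem_singleton, mem_biUnion]
    by_cases hn0 : n = 0
    · exact Or.inl hn0
    · right
      have : ¬ (1 ≤ n ∧ ∀ i, (x : ℝ) ^ (((f i).natDegree : ℝ) * (1 - δ) / 2) ≤ (((f i).eval (n : ℤ) : ℤ) : ℝ)) := by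
        intro h
        exact hnT (by simp only [hT, mem_filter]; exact ⟨hnS, h⟩)
      push Not at this
      obtain ⟨i, hi⟩ := this (by omega)
      exact ⟨i, mem_univ i, by simp only [hB, mem_filter]; exact ⟨hnS, hi⟩⟩
  -- (3) `#(B i) ≤ M i + (2√x + 1)`
  have hBcard : ∀ i, (#(B i) : ℝ) ≤ M i + (2 * Real.sqrt x + 1) := by
    intro i
    have hsub : B i ⊆ range (M i) ∪ Iic ⌊2 * Real.sqrt x⌋₊ := by
      intro n hn
      simp only [hB, hSP, mem_filter, mem_range] at hn
      obtain ⟨⟨hnx, -⟩, hsmall⟩ := hn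
      rw [mem_union, mem_range, mem_Iic]
      by_cases hMn : n < M i
      · exact Or.inl hMn
      · right
        push Not at hMn
        apply Nat.le_floor
        -- show `(n : ℝ) ≤ 2 √x`
        by_contra hlt
        push Not at hlt
        have hsx : 0 ≤ Real.sqrt x := Real.sqrt_nonneg _
        have hn1 : 1 ≤ n := by
          by_contra h0
          push Not at h0
          have : n = 0 := by omega
          subst this
          simp at hlt
          linarith
        have hx1 : (1 : ℝ) ≤ x := by exact_mod_cast hn1.trans (by omega : n ≤ x)
        have hx0 : (0 : ℝ) ≤ x := by linarith
        set d := (f i).natDegree with hd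
        have hd1 : 1 ≤ d := hdeg i
        -- `n^d ≤ 2 fᵢ(n) < 2 zᵢ ≤ 2 x^{d/2} = 2 (√x)^d ≤ (2√x)^d < n^d`
        have hA : ((n : ℝ)) ^ d ≤ 2 * (((f i).eval (n : ℤ) : ℤ) : ℝ) := by exact_mod_cast hM i n hMn
        have hz : (x : ℝ) ^ ((d : ℝ) * (1 - δ) / 2) ≤ Real.sqrt x ^ d := by
          rw [Real.sqrt_eq_rpow, ← Real.rpow_natCast, ← Real.rpow_mul hx0]
          refine Real.rpow_le_rpow_of_exponent_le hx1 ?_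
          have : (0 : ℝ) ≤ d := Nat.cast_nonneg d
          nlinarith
        have h2d : (2 : ℝ) * Real.sqrt x ^ d ≤ (2 * Real.sqrt x) ^ d := by
          rw [mul_pow]
          refine mul_le_mul_of_nonneg_right ?_ (pow_nonneg hsx d)
          calc (2 : ℝ) = 2 ^ 1 := by norm_num
            _ ≤ 2 ^ d := pow_le_pow_right₀ (by norm_num) hd1
        have hnd : (2 * Real.sqrt x) ^ d < (n : ℝ) ^ d :=
          pow_lt_pow_left₀ hlt (by positivity) (by omega)
        linarith
    calc (#(B i) : ℝ) ≤ #(range (M i) ∪ Iic ⌊2 * Real.sqrt x⌋₊) := by exact_mod_cast card_le_card hsub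
      _ ≤ #(range (M i)) + #(Iic ⌊2 * Real.sqrt x⌋₊) := by exact_mod_cast card_union_le _ _
      _ = M i + (⌊2 * Real.sqrt x⌋₊ + 1 : ℕ) := by rw [card_range, Nat.card_Iic]
      _ ≤ M i + (2 * Real.sqrt x + 1) := by
          push_cast
          have := Nat.floor_le (show 0 ≤ 2 * Real.sqrt x by positivity)
          linarith
  -- (4) assemble
  have hcardSP : (#SP : ℝ) ≤ #T + (1 + ∑ i, (#(B i) : ℝ)) := by
    have h1 : #SP ≤ #(SP \ T) + #T := card_le_card_sdiff_add_card
    have h2 : #(SP \ T) ≤ #({0} ∪ Finset.univ.biUnion B) := card_le_card hdiff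
    have h3 : #({0} ∪ Finset.univ.biUnion B) ≤ 1 + ∑ i, #(B i) :=
      (card_union_le _ _).trans (add_le_add (by simp) card_biUnion_le)
    have h4 : (#SP : ℝ) ≤ #(SP \ T) + #T := by exact_mod_cast h1
    have h5 : (#(SP \ T) : ℝ) ≤ 1 + ∑ i, (#(B i) : ℝ) := by exact_mod_cast h2.trans h3
    linarith
  have hTcard : (#T : ℝ) ≤ #((Icc 1 x).filter (fun n : ℕ => ∀ i, 0 < (f i).eval (n : ℤ) ∧
      ∀ p ∈ range ⌈(x : ℝ) ^ (((f i).natDegree : ℝ) * (1 - δ) / 2)⌉₊,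
        p.Prime → ¬ ((p : ℤ) ∣ (f i).eval (n : ℤ)))) := by exact_mod_cast card_le_card hTsub
  have hsum : ∑ i, (#(B i) : ℝ) ≤ ∑ i, ((M i : ℝ) + (2 * Real.sqrt x + 1)) :=
    sum_le_sum fun i _ => hBcard i
  rw [sum_add_distrib, sum_const, card_univ, Fintype.card_fin, nsmul_eq_mul] at hsum
  rw [hPdef]
  linarith

/-- The same in terms of `roughCount`: `P_f(x) ≤ Φ_f(x, δ) + K + k(2√x + 1)`. So the crux is
EXACTLY a statement about the balanced-semiprime layer (it can fail only from above), and for a BH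
system the excess `Φ_f − P_f` is `≥ −O_f(√x)`. [folklore] -/
theorem polyPrimeCount_le_roughCount_add {k : ℕ} (f : Fin k → ℤ[X])
    (hlc : ∀ i, 0 < (f i).leadingCoeff) (hdeg : ∀ i, 0 < (f i).natDegree) {δ : ℝ} (hδ0 : 0 ≤ δ) :
    ∃ K : ℝ, ∀ x : ℕ, (polyPrimeCount f x : ℝ) ≤
      (roughCount f δ x : ℝ) + K + k * (2 * Real.sqrt x + 1) :=
  polyPrimeCount_le_cruxCount_add f hlc hdeg hδ0

/-! ### Targets (the lead's registered stubs, 2026-08-16T05:16Z skeleton) — no kill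

-- `stub_degreeSplit` : TRUE (glue; landed as `SmoothModulusTwistedHooley.stub_transfer`,
--   `balancedSemiprimeLayer_iff_higherLayer` in `Theorems/RoughValueTransportBalancedSemiprimeLayerDegreeLeTwo.lean`).
-- `stub_higherLayer`  : SURVIVES — open problem in both directions, crux-equivalent
--   (`Negative.HigherLayerNecessary` p75295), relatively consistent (§(e) above, p70540), no cheap kill
--   (`Negative.LargePrimeFactors` p75976: a kill needs P⁺(∏_{n≤x} f(n)) ≥ x^{9/8} i.o. for a cubic,
--   record x^{1+10⁻⁵²}); numerics consistent (docblock NUMERICS). No `_false` theorem can be offered.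
-/

end Summit.Parity.BatemanHorn.Cruxes.BalancedSemiprimeLayer.Disproof
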